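import Literature.Algebra.EuclideanLattices.RegevPointSetUnrank
import Literature.Computability.Complexity.CodeFPBudgets
import Literature.Computability.Complexity.CodeFPLists
import HarnessLib

/-!
# Regev 2004, §3.3: the ranking/unranking of the quantised ball is polynomial time

Topic `Algebra/EuclideanLattices` (family `pqc`); proved material towards the discharge of the
named fact `Literature.Algebra.EuclideanLattices.usvp_of_dihedralCoset` (O. Regev, *Quantum
computation and lattice problems*, SIAM J. Comput. 33 (2004) 738–760, Thm. 1.1). No named fact is
introduced; everything is proved.

`RegevPointSetUnrank.lean` gives the combinatorics of the exact preparation of the register state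
over `pointSet n Q Δ ⊆ qBall n Q Δ = {x ∈ ℤⁿ | ∑ ⌈xᵢ²/Δ⌉ ≤ Q}` (`RegevPointSet.lean`): the counting
table `qCount Δ m q = |qBall m q Δ|` with its grouped recursion over the `2q + 1` bands of the first
coordinate and the explicit `unrank Δ n Q i = nthLex (qBall n Q Δ) i`. This file adds the inverse
direction and realises everything as POLYNOMIAL-TIME maps on codes, in the typed `FP` algebra
`CodeFP` of `Computability/Complexity/CodeFP*.lean` (dimension `n` and level count `Q` in unary,
`Δ`, indices and coordinates in binary; vectors as raw lists of difference-pair integers `intE`):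

* ranking: `bandIdx`/`bandOff` (locating an admissible coordinate in its band, `bandIdx_spec`),
  the explicit `rank Δ n Q x` and `rank_eq_lexRank`, `rank_unrank`, `unrank_rank`,
  `mem_pointSet_iff_rank` (`x ∈ pointSet ↔ x ∈ qBall ∧ rank x < 2^κ`);
* programs: `bandTerm`/`bandTerms` (the band sizes from a row of the table), `nextRow`, `rowOf`
  (`rowOf_getD : (rowOf Δ Q m)[q] = qCount Δ m q`), `tableRev` (the rows `m = d, …, 0`),
  `blockUnrankL` (block unranking as a left scan, `blockUnrankL_eq`), `unrankStep` / `unrankList`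
  (`unrankList_eq : … = List.ofFn (unrank Δ n Q i)`), `rankStep` / `rankList`
  (`rankList_eq : … = rank Δ n Q x`), with the bounds that keep every accumulator polynomial
  (`qCount_le_pow'`, `length_rawE_tableRev_le`, `unrankGo_inv`, `rankGo_le`);
* the `CodeFP` realisations, assembled from the combinators of `CodeFP.lean` (the one obligation at
  each fold being a polynomial bound of the accumulator's code along the run): **`qCountFP`**,
  **`kappaFP`** (`κ = ⌊log₂ |qBall|⌋`), **`unrankFP`**, **`rankFP`**, **`memPointSetFP`**
  (`decide_memPointSet_iff`).

From `unrankFP` a consumer obtains `∃ f ∈ FP, ∀ (n Q Δ i), f ⟨1ⁿ, ⟨1^Q, ⟨bin Δ, bin i⟩⟩⟩ =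
rawE intE (List.ofFn (unrank Δ n Q i))`, hence (`RevCleanPoly.lean`) a garbage-free reversible
circuit block writing the `i`-th grid point; `rankFP` recomputes the index from the point (to erase
the index register) and `memPointSetFP` tests membership of a recomputed point: the exact, oracle-free
replacement of the state preparation of Regev's Lemma 3.11 inside the circuit of Lemma 3.12.

## References

* O. Regev, *Quantum computation and lattice problems*, SIAM J. Comput. 33 (2004) 738–760,
  Lemma 3.11 (the state over the grid points of a ball) and Lemma 3.12 (its use) [Regev2004].
* S. Arora, B. Barak, *Computational Complexity: A Modern Approach*, CUP 2009, §1.3 (polynomial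
  time is closed under composition and polynomially bounded loops).
* A. Nijenhuis, H. S. Wilf, *Combinatorial Algorithms*, 2nd ed., Academic Press 1978, Ch. 13
  (ranking and unranking by cumulative counts).
-/

noncomputable section

namespace Literature.Algebra.EuclideanLattices

namespace Regev2004

open _root_.Computability Polynomial Literature.Computability.Complexity
  Literature.Computability.Complexity.CodeFP Literature.Computability.Complexity.Brick

/-! ### Ranking (the inverse of `unrank`) -/

/-- In dimension `0` every rank is `0`. [folklore] -/
theorem lexRank_fin_zero (S : Finset (Fin 0 → ℤ)) (x : Fin 0 → ℤ) : lexRank S x = 0 := by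
  rw [lexRank, Finset.card_eq_zero, Finset.filter_eq_empty_iff]
  intro y _ h
  have : y = x := funext fun j => Fin.elim0 j
  rw [this] at h
  exact lt_irrefl _ h

/-- The band index of a first coordinate `v`: `Q − ⌈v²/Δ⌉` for negative `v`, `Q + ⌈v²/Δ⌉`
otherwise. [folklore] -/
def bandIdx (Δ Q : ℕ) (v : ℤ) : ℕ := if v < 0 then Q - qWeight Δ v else Q + qWeight Δ v

/-- The offset of `v` inside its band. [folklore] -/
def bandOff (Δ Q : ℕ) (v : ℤ) : ℕ := (v - bandStart Δ Q (bandIdx Δ Q v)).toNat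

/-- **Locating an admissible coordinate in the bands**: its band index is `≤ 2Q`, the band has
level `⌈v²/Δ⌉`, the offset is below the band length, and `v = bandStart + bandOff`. [folklore] -/
theorem bandIdx_spec {Δ : ℕ} (hΔ : 0 < Δ) {Q : ℕ} {v : ℤ} (hv : qWeight Δ v ≤ Q) :
    bandIdx Δ Q v ≤ 2 * Q ∧ bandLevel Q (bandIdx Δ Q v) = qWeight Δ v ∧
      bandOff Δ Q v < bandLen Δ (qWeight Δ v) ∧ v = bandStart Δ Q (bandIdx Δ Q v) + bandOff Δ Q v := by
  unfold bandOff bandIdx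
  rcases lt_trichotomy v 0 with h | rfl | h
  · -- negative: level `j + 1`, band `Q - (j + 1)`
    have hne : qWeight Δ v ≠ 0 := fun h0 => by rw [qWeight_eq_zero_iff hΔ] at h0; omega
    obtain ⟨j, hj⟩ : ∃ j, qWeight Δ v = j + 1 := ⟨qWeight Δ v - 1, by omega⟩
    have hjv := (qWeight_eq_succ_iff hΔ v j).1 hj
    rw [if_pos h, hj]
    have hk : Q - (j + 1) ≤ Q := Nat.sub_le _ _
    rw [bandLevel_of_le hk, bandStart_of_le Δ hk, show Q - (Q - (j + 1)) = j + 1 from by omega, bandLen_succ]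
    have hmono := bLev_mono Δ (Nat.le_succ j)
    refine ⟨by omega, rfl, ?_, ?_⟩
    · have : (v - -(bLev Δ (j + 1) : ℤ)).toNat = bLev Δ (j + 1) - v.natAbs := by omega
      rw [this]
      omega
    · omega
  · -- zero
    have h0 : qWeight Δ 0 = 0 := (qWeight_eq_zero_iff hΔ 0).2 rfl
    rw [if_neg (lt_irrefl _), h0, Nat.add_zero, bandLevel_of_le le_rfl, bandStart_of_le Δ le_rfl, Nat.sub_self,
      bLev_zero, bandLen_zero]
    simp only [Nat.cast_zero, neg_zero, sub_zero, Int.toNat_zero, zero_lt_one, add_zero, and_true]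
    omega
  · -- positive: level `j + 1`, band `Q + (j + 1)`
    have hne : qWeight Δ v ≠ 0 := fun h0 => by rw [qWeight_eq_zero_iff hΔ] at h0; omega
    obtain ⟨j, hj⟩ : ∃ j, qWeight Δ v = j + 1 := ⟨qWeight Δ v - 1, by omega⟩
    have hjv := (qWeight_eq_succ_iff hΔ v j).1 hj
    rw [if_neg (not_lt.2 h.le), hj]
    have hk : Q < Q + (j + 1) := by omega
    rw [bandLevel_of_ge hk.le, bandStart_of_lt Δ hk, show Q + (j + 1) - Q - 1 = j from by omega,
      show Q + (j + 1) - Q = j + 1 from by omega, bandLen_succ]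
    refine ⟨by omega, rfl, ?_, ?_⟩
    · have : (v - ((bLev Δ j : ℤ) + 1)).toNat = v.natAbs - (bLev Δ j + 1) := by omega
      rw [this]
      omega
    · omega

/-- **`below` of an admissible coordinate, explicitly**: the sizes of the earlier bands plus the
offset times the fibre size. [folklore] -/
theorem below_eq_of_qWeight_le {Δ : ℕ} (hΔ : 0 < Δ) (m : ℕ) {Q : ℕ} {v : ℤ} (hv : qWeight Δ v ≤ Q) :
    below Δ m Q v = ((bandSizes Δ m Q).take (bandIdx Δ Q v)).sum + bandOff Δ Q v * qCount Δ m (Q - qWeight Δ v) := by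
  obtain ⟨hk, hlev, hoff, hv'⟩ := bandIdx_spec hΔ hv
  conv_lhs => rw [hv']
  rw [below_bandStart_add hΔ m Q hk (by rw [hlev]; exact hoff.le), sum_take_bandSizes hΔ m Q (by omega), hlev,
    qCount_eq_card hΔ]

/-- **The explicit ranking of the quantised ball**: locate the first coordinate in its band, add
the sizes of the earlier bands and the offset times the fibre size, and recurse on the tail with
the remaining budget. [folklore] -/
def rank (Δ : ℕ) : (m : ℕ) → ℕ → (Fin m → ℤ) → ℕ
  | 0, _, _ => 0
  | m + 1, Q, x =>
      ((bandSizes Δ m Q).take (bandIdx Δ Q (x 0))).sum + bandOff Δ Q (x 0) * qCount Δ m (Q - qWeight Δ (x 0)) +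
        rank Δ m (Q - qWeight Δ (x 0)) (Fin.tail x)

/-- The recursion of `rank` at a successor. [folklore] -/
theorem rank_succ (Δ m Q : ℕ) (x : Fin (m + 1) → ℤ) : rank Δ (m + 1) Q x =
    ((bandSizes Δ m Q).take (bandIdx Δ Q (x 0))).sum + bandOff Δ Q (x 0) * qCount Δ m (Q - qWeight Δ (x 0)) +
      rank Δ m (Q - qWeight Δ (x 0)) (Fin.tail x) := rfl

/-- **Correctness of ranking**: on the quantised ball, `rank` is the lexicographic rank. [folklore] -/
theorem rank_eq_lexRank {Δ : ℕ} (hΔ : 0 < Δ) : ∀ (m Q : ℕ) (x : Fin m → ℤ), x ∈ qBall m Q Δ →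
    rank Δ m Q x = lexRank (qBall m Q Δ) x
  | 0, Q, x, _ => by rw [rank, lexRank_fin_zero]
  | m + 1, Q, x, hx => by
      rw [← consV_self_tail x, consV_mem_qBall_iff hΔ] at hx
      rw [rank_succ, ← below_eq_of_qWeight_le hΔ m hx.1, rank_eq_lexRank hΔ m _ _ hx.2]
      conv_rhs => rw [← consV_self_tail x, lexRank_qBall_consV hΔ m Q _ _ hx.1]

/-- `rank` inverts `unrank` on `[0, |qBall|)`. [folklore] -/
theorem rank_unrank {Δ : ℕ} (hΔ : 0 < Δ) {m Q i : ℕ} (hi : i < (qBall m Q Δ).card) :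
    rank Δ m Q (unrank Δ m Q i) = i := by
  rw [rank_eq_lexRank hΔ m Q _ (unrank_mem hΔ hi), lexRank_unrank hΔ hi]

/-- Ranks are below `|qBall|`. [folklore] -/
theorem rank_lt_card {Δ : ℕ} (hΔ : 0 < Δ) {m Q : ℕ} {x : Fin m → ℤ} (hx : x ∈ qBall m Q Δ) :
    rank Δ m Q x < (qBall m Q Δ).card := by
  rw [rank_eq_lexRank hΔ m Q x hx]
  exact lexRank_lt_card hx

/-- `unrank` inverts `rank` on the quantised ball. [folklore] -/
theorem unrank_rank {Δ : ℕ} (hΔ : 0 < Δ) {m Q : ℕ} {x : Fin m → ℤ} (hx : x ∈ qBall m Q Δ) :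
    unrank Δ m Q (rank Δ m Q x) = x := by
  rw [unrank_eq_nthLex hΔ (rank_lt_card hΔ hx), nthLex_eq_iff]
  exact ⟨hx, (rank_eq_lexRank hΔ m Q x hx).symm⟩

/-- **Membership in the point set by the explicit rank**: `x ∈ pointSet ↔ x ∈ qBall ∧ rank x < 2^κ`
(the test a circuit applies to a recomputed point). [folklore] -/
theorem mem_pointSet_iff_rank {Δ : ℕ} (hΔ : 0 < Δ) (m Q : ℕ) (x : Fin m → ℤ) :
    x ∈ pointSet m Q Δ hΔ ↔ x ∈ qBall m Q Δ ∧ rank Δ m Q x < 2 ^ kappa m Q Δ := by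
  rw [mem_pointSet_iff_lexRank]
  constructor
  · rintro ⟨hx, hr⟩
    exact ⟨hx, by rwa [rank_eq_lexRank hΔ m Q x hx]⟩
  · rintro ⟨hx, hr⟩
    exact ⟨hx, by rwa [← rank_eq_lexRank hΔ m Q x hx]⟩

/-! ### Two more typed leaves: sums of numerals, the level boundaries -/

/-- A left fold of `+` is the sum. [folklore] -/
theorem foldl_add_eq_sum_nat (l : List ℕ) (acc : ℕ) : l.foldl (fun acc a => acc + a) acc = acc + l.sum := by
  induction l generalizing acc with
  | nil => simp
  | cons a l ih => rw [List.foldl_cons, ih, List.sum_cons, Nat.add_assoc]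

/-- **Sums of raw lists of numerals** are polynomial time (a twin of `HiraharaMachine.natSum` of
`Computability/Complexity/HiraharaMachineParams.lean`, whose import closure — the Hirahara machine — is not
wanted here; canonical home would be `CodeFPBudgets.lean` next to `intSum`). [cite: AroraBarak2009, §1.3] -/
theorem natSumFP : CodeFP (rawE natE) natE List.sum := by
  have hstep : CodeFP (pairE natE natE) natE (fun t => t.2 + t.1) := (natAdd.comp ((snd _ _).pair (fst _ _)) :)
  have h := foldl₀ (step := fun (a : ℕ) acc => acc + a) (b₀ := 0) hstep (2 * X) (fun l₁ l₂ => by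
      rw [foldl_add_eq_sum_nat, zero_add, eval_mul, eval_ofNat, eval_X, length_natE]
      set L := (rawE natE (l₁ ++ l₂)).length
      have hitem : ∀ z ∈ l₁, Nat.size z ≤ L := fun z hz => by
        have := length_item_le_length_rawE natE (List.mem_append_left l₂ hz)
        rw [← length_natE]
        omega
      have hlen : l₁.length ≤ L := le_trans (by simp) (length_le_length_rawE natE (l₁ ++ l₂))
      have := size_sum_le hitem
      omega)
  exact h.congr fun l => by rw [foldl_add_eq_sum_nat, zero_add]

/-- `(Δ, j) ↦ bLev Δ j = ⌊√(jΔ)⌋`. [folklore] -/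
theorem bLevFP : CodeFP (pairE natE natE) natE (fun p => bLev p.1 p.2) :=
  (natSqrt.comp (natMul.comp ((snd _ _).pair (fst _ _)))).congr fun _ => rfl

/-- `(Δ, j) ↦ bandLen Δ j`. [folklore] -/
theorem bandLenFP : CodeFP (pairE natE natE) natE (fun p => bandLen p.1 p.2) := by
  have h1 : CodeFP (pairE natE natE) natE (fun p => bLev p.1 (p.2 - 1)) :=
    (bLevFP.comp ((fst _ _).pair (natSub.comp ((snd _ _).pair (const _ 1)))) :)
  refine (((natEq.comp ((snd _ _).pair (const _ 0))).ite (const _ 1) (natSub.comp (bLevFP.pair h1))).congr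
    fun p => ?_)
  unfold bandLen
  by_cases h : p.2 = 0 <;> simp [h]

/-- `(q, k) ↦ bandLevel q k`. [folklore] -/
theorem bandLevelFP : CodeFP (pairE natE natE) natE (fun p => bandLevel p.1 p.2) :=
  (natAdd.comp (natSub.pair (natSub.comp ((snd _ _).pair (fst _ _))))).congr fun _ => rfl

/-- `(Δ, q, k) ↦ bandStart Δ q k` (an integer). [folklore] -/
theorem bandStartFP : CodeFP (pairE natE (pairE natE natE)) intE (fun p => bandStart p.1 p.2.1 p.2.2) := by
  let cE : ℕ × (ℕ × ℕ) → List Bool := pairE natE (pairE natE natE)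
  have hΔ : CodeFP cE natE (fun p => p.1) := fst _ _
  have hq : CodeFP cE natE (fun p => p.2.1) := (snd _ _).fst'
  have hk : CodeFP cE natE (fun p => p.2.2) := (snd _ _).snd'
  have hneg : CodeFP cE intE (fun p => -((bLev p.1 (p.2.1 - p.2.2) : ℕ) : ℤ)) :=
    (intNeg.comp (intOfNat.comp (bLevFP.comp (hΔ.pair (natSub.comp (hq.pair hk))))) :)
  have hj : CodeFP cE natE (fun p => p.2.2 - p.2.1 - 1) := (natSub.comp ((natSub.comp (hk.pair hq)).pair (const _ 1)) :)
  have hb : CodeFP cE intE (fun p => ((bLev p.1 (p.2.2 - p.2.1 - 1) : ℕ) : ℤ)) := (intOfNat.comp (bLevFP.comp (hΔ.pair hj)) :)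
  have hone : CodeFP cE intE (fun _ => (1 : ℤ)) := const _ _
  have hpos : CodeFP cE intE (fun p => ((bLev p.1 (p.2.2 - p.2.1 - 1) : ℕ) : ℤ) + 1) := (intAdd.comp (hb.pair hone) :)
  refine (((natLe.comp (hk.pair hq)).ite hneg hpos).congr fun p => ?_)
  unfold bandStart
  by_cases h : p.2.2 ≤ p.2.1 <;> simp [h]

/-- `(Δ, v) ↦ qWeight Δ v = ⌈v²/Δ⌉`. [folklore] -/
theorem qWeightFP : CodeFP (pairE natE intE) natE (fun p => qWeight p.1 p.2) := by
  have ha : CodeFP (pairE natE intE) natE (fun p => p.2.natAbs) := intNatAbs.comp (snd _ _)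
  refine ((natDiv.comp ((natAdd.comp ((natMul.comp (ha.pair ha)).pair (natSub.comp ((fst _ _).pair
    (const _ 1))))).pair (fst _ _))).congr fun p => ?_)
  simp [qWeight, sq]

/-! ### The counting table as a program -/

/-- One band size from a row of the table: `bandLen Δ (level q k) · row[q − level q k]`. [folklore] -/
def bandTerm (Δ q : ℕ) (row : List ℕ) (k : ℕ) : ℕ := bandLen Δ (bandLevel q k) * row.getD (q - bandLevel q k) 0

/-- The band sizes of level `q` from a row, with the loop bound `2q + 1` capped by the budget
`2Q + 1` (no cap when `q ≤ Q`). [folklore] -/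
def bandTerms (Δ Q q : ℕ) (row : List ℕ) : List ℕ := (List.range (min (2 * q + 1) (2 * Q + 1))).map (bandTerm Δ q row)

/-- The next row of the table: entry `q ≤ Q` is the sum of the band sizes of level `q`. [folklore] -/
def nextRow (Δ Q : ℕ) (row : List ℕ) : List ℕ := (List.range (Q + 1)).map fun q => (bandTerms Δ Q q row).sum

/-- Row `m` of the table: `[qCount Δ m 0, …, qCount Δ m Q]`. [folklore] -/
def rowOf (Δ Q : ℕ) : ℕ → List ℕ
  | 0 => List.replicate (Q + 1) 1
  | m + 1 => nextRow Δ Q (rowOf Δ Q m)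

/-- Rows have `Q + 1` entries. [folklore] -/
@[simp] theorem length_rowOf (Δ Q : ℕ) : ∀ m, (rowOf Δ Q m).length = Q + 1
  | 0 => by simp [rowOf]
  | m + 1 => by simp [rowOf, nextRow]

/-- With an uncapped loop bound, the band sizes from row `m` are `bandSizes Δ m q`. [folklore] -/
theorem bandTerms_eq_bandSizes {Δ Q q : ℕ} (hq : q ≤ Q) {row : List ℕ} {m : ℕ}
    (hrow : ∀ q' ≤ q, row.getD q' 0 = qCount Δ m q') : bandTerms Δ Q q row = bandSizes Δ m q := by
  rw [bandTerms, min_eq_left (by omega), bandSizes]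
  refine List.map_congr_left fun k hk => ?_
  rw [bandTerm, hrow _ (Nat.sub_le _ _)]

/-- **The rows are the counting table**: `(rowOf Δ Q m)[q] = qCount Δ m q` for `q ≤ Q`. [folklore] -/
theorem rowOf_getD (Δ Q : ℕ) : ∀ (m : ℕ) {q : ℕ}, q ≤ Q → (rowOf Δ Q m).getD q 0 = qCount Δ m q
  | 0, q, hq => by
      rw [rowOf, qCount_zero, List.getD_eq_getElem _ _ (by simpa using Nat.lt_succ_of_le hq)]
      simp
  | m + 1, q, hq => by
      rw [rowOf, nextRow, List.getD_eq_getElem _ _ (by simpa using Nat.lt_succ_of_le hq)]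
      simp only [List.getElem_map, List.getElem_range]
      rw [bandTerms_eq_bandSizes hq fun q' hq' => rowOf_getD Δ Q m (hq'.trans hq), qCount_succ, bandSizes]

/-- The table, latest row first: `tableRev Δ Q d = [rowOf d, …, rowOf 0]`, by `d` rounds of
`nextRow` on the head. [folklore] -/
def tableRev (Δ Q d : ℕ) : List (List ℕ) :=
  (List.replicate d ()).foldl (fun T _ => nextRow Δ Q (T.headD []) :: T) [rowOf Δ Q 0]

/-- The fold behind `tableRev`, from any stage. [folklore] -/
theorem foldl_nextRow_cons (Δ Q : ℕ) : ∀ (d m : ℕ) (T : List (List ℕ)),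
    (List.replicate d ()).foldl (fun T _ => nextRow Δ Q (T.headD []) :: T) (rowOf Δ Q m :: T) =
      ((List.range (d + 1)).map fun t => rowOf Δ Q (m + t)).reverse ++ T
  | 0, m, T => by simp
  | d + 1, m, T => by
      rw [List.replicate_succ, List.foldl_cons, List.headD_cons,
        show nextRow Δ Q (rowOf Δ Q m) = rowOf Δ Q (m + 1) from rfl, foldl_nextRow_cons Δ Q d (m + 1) (rowOf Δ Q m :: T)]
      have : (fun t => rowOf Δ Q (m + 1 + t)) = ((fun t => rowOf Δ Q (m + t)) ∘ Nat.succ) := by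
        funext t
        simp only [Function.comp_apply, Nat.succ_eq_add_one]
        congr 1
        omega
      rw [this]
      conv_rhs => rw [List.range_succ_eq_map, List.map_cons, List.map_map, List.reverse_cons, List.append_assoc,
        List.singleton_append]
      rfl

/-- **Closed form of the table.** [folklore] -/
theorem tableRev_eq (Δ Q d : ℕ) : tableRev Δ Q d = ((List.range (d + 1)).map (rowOf Δ Q)).reverse := by
  have h := foldl_nextRow_cons Δ Q d 0 []
  simp only [Nat.zero_add, List.append_nil] at h
  exact h

/-- The table has `d + 1` rows. [folklore] -/
@[simp] theorem length_tableRev (Δ Q d : ℕ) : (tableRev Δ Q d).length = d + 1 := by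
  simp [tableRev_eq]

/-- **Entries of the table**: item `t ≤ d` of `tableRev Δ Q d` is `rowOf Δ Q (d − t)`. [folklore] -/
theorem tableRev_getD {Δ Q d t : ℕ} (ht : t ≤ d) : (tableRev Δ Q d).getD t [] = rowOf Δ Q (d - t) := by
  rw [tableRev_eq, List.getD_eq_getElem _ _ (by simpa using Nat.lt_succ_of_le ht)]
  simp only [List.getElem_reverse, List.length_map, List.length_range, List.getElem_map, List.getElem_range]
  congr 1

/-- Every row of the table is some `rowOf`. [folklore] -/
theorem mem_tableRev {Δ Q d : ℕ} {row : List ℕ} (h : row ∈ tableRev Δ Q d) : ∃ m ≤ d, row = rowOf Δ Q m := by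
  rw [tableRev_eq, List.mem_reverse, List.mem_map] at h
  obtain ⟨m, hm, rfl⟩ := h
  exact ⟨m, by rw [List.mem_range] at hm; omega, rfl⟩

/-- **Entries of the rows are bounded**: every entry of `rowOf Δ Q m` is at most `(2 bLev Δ Q + 1)^m`. [folklore] -/
theorem rowOf_entry_le {Δ : ℕ} (hΔ : 0 < Δ) (Q m : ℕ) {c : ℕ} (hc : c ∈ rowOf Δ Q m) : c ≤ (2 * bLev Δ Q + 1) ^ m := by
  obtain ⟨q, hq, rfl⟩ := List.getElem_of_mem hc
  have hqQ : q ≤ Q := by have := hq; simp at this; omega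
  have h := rowOf_getD Δ Q m hqQ
  rw [List.getD_eq_getElem _ _ hq] at h
  rw [h]
  exact (qCount_le_pow hΔ m q).trans (Nat.pow_le_pow_left (by have := bLev_mono Δ hqQ; omega) m)

/-- The sum of the band lengths over the `2q + 1` bands telescopes to `2 bLev Δ q + 1`. [folklore] -/
theorem sum_bandLen_bandLevel (Δ q : ℕ) :
    ((List.range (2 * q + 1)).map fun k => bandLen Δ (bandLevel q k)).sum = 2 * bLev Δ q + 1 := by
  -- split the range at `q` and at `q + 1`
  have hneg : ∀ n ≤ q, ((List.range n).map fun k => bandLen Δ (bandLevel q k)).sum = bLev Δ q - bLev Δ (q - n) := by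
    intro n hn
    induction n with
    | zero => simp
    | succ n ih =>
      rw [List.range_succ, List.map_append, List.sum_append, ih (by omega), List.map_singleton, List.sum_singleton,
        bandLevel_of_le (by omega), show q - n = q - (n + 1) + 1 from by omega, bandLen_succ]
      have h1 := bLev_mono Δ (show q - (n + 1) ≤ q - (n + 1) + 1 by omega)
      have h2 := bLev_mono Δ (show q - (n + 1) + 1 ≤ q by omega)
      omega
  have hpos : ∀ n ≤ q, ((List.range n).map fun k => bandLen Δ (bandLevel q (q + 1 + k))).sum = bLev Δ n := by
    intro n hn
    induction n with
    | zero => simp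
    | succ n ih =>
      rw [List.range_succ, List.map_append, List.sum_append, ih (by omega), List.map_singleton, List.sum_singleton,
        bandLevel_of_ge (by omega), show q + 1 + n - q = n + 1 from by omega, bandLen_succ]
      have := bLev_mono Δ (show n ≤ n + 1 by omega)
      omega
  rw [show 2 * q + 1 = q + 1 + q by ring, List.range_add, List.map_append, List.sum_append, List.range_succ,
    List.map_append, List.sum_append, hneg q le_rfl, List.map_singleton, List.sum_singleton, bandLevel_of_le le_rfl,
    Nat.sub_self, bLev_zero, bandLen_zero, List.map_map]
  have : ((fun k => bandLen Δ (bandLevel q k)) ∘ fun k => q + 1 + k) = fun k => bandLen Δ (bandLevel q (q + 1 + k)) := rfl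
  rw [this, hpos q le_rfl]
  omega

/-- **Entries of the counting table are at most `(2 bLev Δ q + 1)^m`**, for every `Δ` (from the
recursion: the band lengths add up to `2 bLev Δ q + 1`, the entries are monotone in `q`). [folklore] -/
theorem qCount_le_pow' (Δ : ℕ) : ∀ m q, qCount Δ m q ≤ (2 * bLev Δ q + 1) ^ m
  | 0, q => by simp
  | m + 1, q => by
      rw [qCount_succ, pow_succ']
      calc ((List.range (2 * q + 1)).map fun k => bandLen Δ (bandLevel q k) * qCount Δ m (q - bandLevel q k)).sum
          ≤ ((List.range (2 * q + 1)).map fun k => bandLen Δ (bandLevel q k) * (2 * bLev Δ q + 1) ^ m).sum := by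
            refine List.sum_le_sum fun k _ => Nat.mul_le_mul_left _ ?_
            exact (qCount_le_pow' Δ m _).trans (Nat.pow_le_pow_left (by have := bLev_mono Δ (Nat.sub_le q (bandLevel q k)); omega) m)
        _ = (2 * bLev Δ q + 1) * (2 * bLev Δ q + 1) ^ m := by
            rw [← sum_bandLen_bandLevel Δ q, ← List.sum_map_mul_right]

/-- Entries of `rowOf Δ Q m` are at most `(2 bLev Δ Q + 1)^m`, for every `Δ`. [folklore] -/
theorem rowOf_entry_le' (Δ Q m : ℕ) {c : ℕ} (hc : c ∈ rowOf Δ Q m) : c ≤ (2 * bLev Δ Q + 1) ^ m := by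
  obtain ⟨q, hq, rfl⟩ := List.getElem_of_mem hc
  have hqQ : q ≤ Q := by have := hq; simp at this; omega
  have h := rowOf_getD Δ Q m hqQ
  rw [List.getD_eq_getElem _ _ hq] at h
  rw [h]
  exact (qCount_le_pow' Δ m q).trans (Nat.pow_le_pow_left (by have := bLev_mono Δ hqQ; omega) m)

/-! ### Code sizes -/

/-- A raw code is bounded by the number of items times a bound on the item codes (a twin of
`LMat.length_rawE_le_mul` of `Computability/Complexity/AOWListMatrixFP.lean`, not imported for its closure). [folklore] -/
theorem length_rawE_le_of_forall {α : Type} (e : α → List Bool) {l : List α} {E : ℕ}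
    (h : ∀ a ∈ l, (e a).length ≤ E) : (rawE e l).length ≤ l.length * (2 * E + 2) := by
  induction l with
  | nil => simp
  | cons a l ih =>
    rw [rawE_cons, length_boolPair, List.length_cons]
    have ha := h a List.mem_cons_self
    have hl := ih fun b hb => h b (List.mem_cons_of_mem _ hb)
    nlinarith

/-- `bLev Δ Q < 2^(Q + size Δ)`, so `size (2 bLev Δ Q + 1) ≤ Q + size Δ + 1`. [folklore] -/
theorem size_two_mul_bLev_succ_le (Δ Q : ℕ) : Nat.size (2 * bLev Δ Q + 1) ≤ Q + Nat.size Δ + 1 := by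
  rw [Nat.size_le]
  have h1 : bLev Δ Q ≤ Q * Δ := Nat.sqrt_le_self _
  have h2 : Q * Δ < 2 ^ Q * 2 ^ Nat.size Δ := by
    rcases Nat.eq_zero_or_pos Δ with rfl | hΔ
    · simp
    · exact Nat.mul_lt_mul_of_le_of_lt (Nat.lt_two_pow_self).le (Nat.lt_size_self Δ) (Nat.two_pow_pos Q)
  rw [pow_succ, pow_add]
  omega

/-- **Code length of a row** with entries at most `(2 bLev Δ Q + 1)^d`. [folklore] -/
theorem length_rawE_row_le {Δ Q d : ℕ} {row : List ℕ} (hlen : row.length = Q + 1)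
    (h : ∀ c ∈ row, c ≤ (2 * bLev Δ Q + 1) ^ d) :
    (rawE natE row).length ≤ (Q + 1) * (2 * (d * (Q + Nat.size Δ + 1) + 1) + 2) := by
  rw [← hlen]
  refine length_rawE_le_of_forall natE fun c hc => ?_
  rw [length_natE]
  exact (size_mono (h c hc)).trans ((size_pow_le _ _).trans (by have := size_two_mul_bLev_succ_le Δ Q; nlinarith))

/-- **Code length of the table.** [folklore] -/
theorem length_rawE_tableRev_le (Δ Q d : ℕ) :
    (rawE (rawE natE) (tableRev Δ Q d)).length ≤ (d + 1) * (2 * ((Q + 1) * (2 * (d * (Q + Nat.size Δ + 1) + 1) + 2)) + 2) := by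
  rw [← length_tableRev Δ Q d]
  refine length_rawE_le_of_forall (rawE natE) fun row hrow => ?_
  obtain ⟨m, hm, rfl⟩ := mem_tableRev hrow
  refine length_rawE_row_le (length_rowOf Δ Q m) fun c hc => (rowOf_entry_le' Δ Q m hc).trans ?_
  exact Nat.pow_le_pow_right (Nat.succ_pos _) hm

/-! ### The table on codes -/

/-- The context of a band computation: `(Δ, q, row)`. [folklore] -/
abbrev bandCtxE : ℕ × (ℕ × List ℕ) → List Bool := pairE natE (pairE natE (rawE natE))

/-- **One band size on codes**: `((Δ, q, row), k) ↦ bandTerm Δ q row k`. [cite: AroraBarak2009, §1.3] -/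
theorem bandTermFP : CodeFP (pairE bandCtxE natE) natE (fun p => bandTerm p.1.1 p.1.2.1 p.1.2.2 p.2) := by
  let cE : (ℕ × (ℕ × List ℕ)) × ℕ → List Bool := pairE bandCtxE natE
  have hΔ : CodeFP cE natE (fun p => p.1.1) := (fst _ _).fst'
  have hq : CodeFP cE natE (fun p => p.1.2.1) := (fst _ _).snd'.fst'
  have hrow : CodeFP cE (rawE natE) (fun p => p.1.2.2) := (fst _ _).snd'.snd'
  have hk : CodeFP cE natE (fun p => p.2) := snd _ _
  have hlev : CodeFP cE natE (fun p => bandLevel p.1.2.1 p.2) := (bandLevelFP.comp (hq.pair hk) :)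
  have hlen : CodeFP cE natE (fun p => bandLen p.1.1 (bandLevel p.1.2.1 p.2)) := (bandLenFP.comp (hΔ.pair hlev) :)
  have hget : CodeFP cE natE (fun p => p.1.2.2.getD (p.1.2.1 - bandLevel p.1.2.1 p.2) 0) :=
    ((rawGetD natE (d := 0) rfl).comp (hrow.pair (natSub.comp (hq.pair hlev))) :)
  exact (natMul.comp (hlen.pair hget)).congr fun _ => rfl

/-- **The band sizes of a level on codes**: `((1^Q, Δ), q, row) ↦ bandTerms Δ Q q row`. [cite: AroraBarak2009, §1.3] -/
theorem bandTermsFP : CodeFP (pairE (pairE unE natE) (pairE natE (rawE natE))) (rawE natE)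
    (fun p => bandTerms p.1.2 p.1.1 p.2.1 p.2.2) := by
  let cE : (ℕ × ℕ) × (ℕ × List ℕ) → List Bool := pairE (pairE unE natE) (pairE natE (rawE natE))
  have hQ : CodeFP cE unE (fun p => p.1.1) := (fst _ _).fst'
  have hΔ : CodeFP cE natE (fun p => p.1.2) := (fst _ _).snd'
  have hq : CodeFP cE natE (fun p => p.2.1) := (snd _ _).fst'
  have hrow : CodeFP cE (rawE natE) (fun p => p.2.2) := (snd _ _).snd'
  -- the budget `1^{2Q+1}` and the bound `2q + 1`
  have hbud : CodeFP cE unE (fun p => p.1.1 + p.1.1 + 1) := (unSucc.comp (unAdd.comp (hQ.pair hQ)) :)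
  have hbnd : CodeFP cE natE (fun p => 2 * p.2.1 + 1) := (natAdd.comp ((natMul.comp ((const _ 2).pair hq)).pair (const _ 1)) :)
  have hrange : CodeFP cE (rawE natE) (fun p => List.range (min (2 * p.2.1 + 1) (p.1.1 + p.1.1 + 1))) :=
    (rangeOf.comp (hbud.pair hbnd) :)
  have hctx : CodeFP cE bandCtxE (fun p => (p.1.2, (p.2.1, p.2.2))) := hΔ.pair (hq.pair hrow)
  refine ((map bandTermFP).comp (hctx.pair hrange)).congr fun p => ?_
  simp only [bandTerms, two_mul]

/-- **The next row on codes**: `(1^Q, Δ, row) ↦ nextRow Δ Q row`. [cite: AroraBarak2009, §1.3] -/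
theorem nextRowFP : CodeFP (pairE unE (pairE natE (rawE natE))) (rawE natE) (fun p => nextRow p.2.1 p.1 p.2.2) := by
  let cE : ℕ × (ℕ × List ℕ) → List Bool := pairE unE (pairE natE (rawE natE))
  -- the item map `((1^Q, Δ, row), q) ↦ (bandTerms Δ Q q row).sum`
  have hitem : CodeFP (pairE cE natE) natE (fun t => (bandTerms t.1.2.1 t.1.1 t.2 t.1.2.2).sum) :=
    (natSumFP.comp (bandTermsFP.comp ((((fst _ _).fst').pair (fst _ _).snd'.fst').pair ((snd _ _).pair
      (fst _ _).snd'.snd'))) :)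
  have hrange : CodeFP cE (rawE natE) (fun p => List.range (p.1 + 1)) := (urange.comp (unSucc.comp (fst _ _)) :)
  exact ((map hitem).comp ((CodeFP.id cE).pair hrange)).congr fun _ => rfl

/-- Row `0` on codes: `1^Q ↦ replicate (Q + 1) 1`. [folklore] -/
theorem rowZeroFP : CodeFP unE (rawE natE) (fun Q => List.replicate (Q + 1) 1) :=
  ((replicateOf natE).comp ((const _ 1).pair unSucc)).congr fun _ => rfl

/-- **The table on codes**: `(1^d, 1^Q, Δ) ↦ tableRev Δ Q d`, a fold of `nextRow` over a budget of
`d` units whose accumulator is polynomially bounded by `length_rawE_tableRev_le`. [cite: AroraBarak2009, §1.3] -/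
theorem tableRevFP : CodeFP (pairE unE (pairE unE natE)) (rawE (rawE natE)) (fun p => tableRev p.2.2 p.2.1 p.1) := by
  let sE : ℕ × ℕ → List Bool := pairE unE natE
  -- the step `((1^Q, Δ), (), T) ↦ nextRow Δ Q (T.headD []) :: T`
  have hT : CodeFP (pairE sE (pairE unitE (rawE (rawE natE)))) (rawE (rawE natE)) (fun t => t.2.2) := (snd _ _).snd'
  have hhead : CodeFP (pairE sE (pairE unitE (rawE (rawE natE)))) (rawE natE) (fun t => t.2.2.headD []) :=
    ((rawHeadD (rawE natE) (d := ([] : List ℕ)) rfl).comp hT :)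
  have hstep : CodeFP (pairE sE (pairE unitE (rawE (rawE natE)))) (rawE (rawE natE))
      (fun t => nextRow t.1.2 t.1.1 (t.2.2.headD []) :: t.2.2) :=
    ((rawCons (rawE natE)).comp ((nextRowFP.comp ((fst _ _).fst'.pair ((fst _ _).snd'.pair hhead))).pair hT) :)
  have hinit : CodeFP sE (rawE (rawE natE)) (fun s => [rowOf s.2 s.1 0]) :=
    ((rawSingleton (rawE natE)).comp (rowZeroFP.comp (fst _ _))).congr fun _ => rfl
  have h := foldl (step := fun (s : ℕ × ℕ) (_ : Unit) T => nextRow s.2 s.1 (T.headD []) :: T)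
    (init := fun s => [rowOf s.2 s.1 0]) hstep hinit ((X + 1) * (2 * ((X + 1) * (2 * (X * (X + 1) + 1) + 2)) + 2))
    (fun s l₁ l₂ => by
      obtain ⟨Q, Δ⟩ := s
      have hfold : l₁.foldl (fun T (_ : Unit) => nextRow Δ Q (T.headD []) :: T) [rowOf Δ Q 0] = tableRev Δ Q l₁.length := by
        rw [tableRev, eq_replicate_unit l₁, List.length_replicate]
      rw [hfold]
      refine (length_rawE_tableRev_le Δ Q l₁.length).trans ?_
      set L := (pairE sE (rawE unitE) ((Q, Δ), l₁ ++ l₂)).length with hL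
      have hLeq : L = 2 * (2 * Q + 2 + Nat.size Δ) + 2 + (rawE unitE (l₁ ++ l₂)).length := by
        simp [hL, sE, length_natE]
      have hraw := length_le_length_rawE unitE (l₁ ++ l₂)
      rw [List.length_append] at hraw
      have hQ : Q ≤ L := by omega
      have hd : l₁.length ≤ L := by omega
      have hQΔ : Q + Nat.size Δ + 1 ≤ L + 1 := by omega
      simp only [eval_add, eval_mul, eval_X, eval_ofNat, eval_one]
      have h1 : l₁.length * (Q + Nat.size Δ + 1) + 1 ≤ L * (L + 1) + 1 :=
        Nat.add_le_add_right (Nat.mul_le_mul hd hQΔ) _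
      have h2 : (Q + 1) * (2 * (l₁.length * (Q + Nat.size Δ + 1) + 1) + 2) ≤ (L + 1) * (2 * (L * (L + 1) + 1) + 2) :=
        Nat.mul_le_mul (by omega) (by omega)
      exact Nat.mul_le_mul (by omega) (by omega))
  exact (h.comp (((snd _ _).fst'.pair (snd _ _).snd').pair (replicateUnit.comp (fst _ _)))).congr fun p => by
    simp only [tableRev]

/-- `headD` is `getD 0`. [folklore] -/
theorem headD_eq_getD_zero {α : Type} (l : List α) (d : α) : l.headD d = l.getD 0 d := by
  cases l <;> rfl

/-- The head of the table is the latest row. [folklore] -/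
theorem tableRev_headD (Δ Q d : ℕ) : (tableRev Δ Q d).headD [] = rowOf Δ Q d := by
  rw [headD_eq_getD_zero, tableRev_getD (Nat.zero_le d), Nat.sub_zero]

/-- **The counting table entry on codes**: `(1ⁿ, 1^Q, Δ) ↦ qCount Δ n Q = |qBall n Q Δ|`
(polynomial in `n`, `Q` and the size of `Δ`). [cite: Regev2004, Lemma 3.11 (the grid points of a ball, counted)] -/
theorem qCountFP : CodeFP (pairE unE (pairE unE natE)) natE (fun p => qCount p.2.2 p.1 p.2.1) := by
  have hrow : CodeFP (pairE unE (pairE unE natE)) (rawE natE) (fun p => (tableRev p.2.2 p.2.1 p.1).headD []) :=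
    (rawHeadD (rawE natE) (d := ([] : List ℕ)) rfl).comp tableRevFP
  have hQ : CodeFP (pairE unE (pairE unE natE)) natE (fun p => p.2.1) := (natOfUn.comp (snd _ _).fst').congr fun _ => rfl
  refine (((rawGetD natE (d := 0) rfl).comp (hrow.pair hQ)).congr fun p => ?_)
  simp only
  rw [tableRev_headD, rowOf_getD _ _ _ le_rfl]

/-- `log₂ x ≤ size x`: the binary length is a budget for the logarithm (a twin of `Khot.log2_le_size` of
`KhotParamsFP.lean`, not imported for its closure). [folklore] -/
theorem log_two_le_size (x : ℕ) : Nat.log 2 x ≤ Nat.size x := by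
  rcases Nat.eq_zero_or_pos x with rfl | hx
  · simp
  · have h1 : 2 ^ Nat.log 2 x ≤ x := Nat.pow_log_le_self 2 hx.ne'
    have h2 : x < 2 ^ Nat.size x := Nat.lt_size_self x
    exact (Nat.pow_lt_pow_iff_right (by norm_num)).1 (lt_of_le_of_lt h1 h2) |>.le

/-- **`κ = ⌊log₂ |qBall n Q Δ|⌋` on codes**: `(1ⁿ, 1^Q, Δ) ↦ Nat.log 2 (qCount Δ n Q)` (`= kappa n Q Δ`
for `Δ ≥ 1`, `kappa_eq_log_qCount`). [cite: Regev2004, Lemma 3.11 (exact power-of-two variant: the number of coins)] -/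
theorem kappaFP : CodeFP (pairE unE (pairE unE natE)) natE (fun p => Nat.log 2 (qCount p.2.2 p.1 p.2.1)) := by
  have hbud : CodeFP natE (rawE unitE) (fun x => List.replicate (natE x).length ()) :=
    (replicateUnit.comp (strLength.comp strOfNat) :)
  have hlog : CodeFP natE natE (fun x => min (List.replicate (natE x).length ()).length (Nat.log 2 x)) :=
    (natLog2Min.comp ((CodeFP.id natE).pair hbud) :)
  have hlog' : CodeFP natE natE (Nat.log 2) := hlog.congr fun x => by
    rw [List.length_replicate, length_natE, min_eq_right (log_two_le_size x)]
  exact hlog'.comp qCountFP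

/-! ### Block unranking as a left scan -/

/-- One step of block unranking as a left scan over the block sizes, on the state
`(found, k, i)`: once found, keep; else stop at the block if `i` fits, otherwise skip it. [folklore] -/
def buStep (s : ℕ) (st : Bool × (ℕ × ℕ)) : Bool × (ℕ × ℕ) :=
  if st.1 then st else if st.2.2 < s then (true, st.2) else (false, (st.2.1 + 1, st.2.2 - s))

/-- After the block is found the scan is idle. [folklore] -/
theorem foldl_buStep_true (sizes : List ℕ) (st : ℕ × ℕ) :
    sizes.foldl (fun st s => buStep s st) (true, st) = (true, st) := by
  induction sizes with
  | nil => rfl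
  | cons s rest ih => rw [List.foldl_cons, show buStep s (true, st) = (true, st) from rfl, ih]

/-- `blockUnrank` on the empty list (definitional). [folklore] -/
theorem blockUnrank_nil (i : ℕ) : BudgetRegion.blockUnrank [] i = (0, i) := rfl

/-- `blockUnrank` on a cons (definitional). [folklore] -/
theorem blockUnrank_cons (s : ℕ) (rest : List ℕ) (i : ℕ) :
    BudgetRegion.blockUnrank (s :: rest) i =
      if i < s then (0, i) else ((BudgetRegion.blockUnrank rest (i - s)).1 + 1, (BudgetRegion.blockUnrank rest (i - s)).2) := rfl

/-- Past the total, `blockUnrank` reports the length and the excess. [folklore] -/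
theorem blockUnrank_of_sum_le : ∀ (sizes : List ℕ) (i : ℕ), sizes.sum ≤ i →
    BudgetRegion.blockUnrank sizes i = (sizes.length, i - sizes.sum)
  | [], i, _ => by rw [blockUnrank_nil]; simp
  | s :: rest, i, h => by
      rw [List.sum_cons] at h
      have hs : ¬ i < s := by omega
      rw [blockUnrank_cons, if_neg hs, blockUnrank_of_sum_le rest (i - s) (by omega), List.length_cons, List.sum_cons,
        Nat.sub_sub]

/-- The offset never exceeds the index. [folklore] -/
theorem blockUnrank_snd_le : ∀ (sizes : List ℕ) (i : ℕ), (BudgetRegion.blockUnrank sizes i).2 ≤ i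
  | [], i => by rw [blockUnrank_nil]
  | s :: rest, i => by
      rw [blockUnrank_cons]
      split_ifs
      · exact le_rfl
      · exact (blockUnrank_snd_le rest (i - s)).trans (Nat.sub_le _ _)

/-- The block index never exceeds the number of blocks. [folklore] -/
theorem blockUnrank_fst_le : ∀ (sizes : List ℕ) (i : ℕ), (BudgetRegion.blockUnrank sizes i).1 ≤ sizes.length
  | [], i => by rw [blockUnrank_nil]; exact le_rfl
  | s :: rest, i => by
      rw [blockUnrank_cons]
      split_ifs
      · exact Nat.zero_le _
      · simpa using blockUnrank_fst_le rest (i - s)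

/-- **The scan computes `blockUnrank`** (with the block counter started at `k`). [folklore] -/
theorem foldl_buStep : ∀ (sizes : List ℕ) (k i : ℕ),
    sizes.foldl (fun st s => buStep s st) (false, (k, i)) =
      if i < sizes.sum then (true, (k + (BudgetRegion.blockUnrank sizes i).1, (BudgetRegion.blockUnrank sizes i).2))
      else (false, (k + sizes.length, i - sizes.sum))
  | [], k, i => by rw [blockUnrank_nil]; simp
  | s :: rest, k, i => by
      rw [List.foldl_cons, List.sum_cons, List.length_cons, blockUnrank_cons]
      by_cases h : i < s
      · have hlt : i < s + rest.sum := by omega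
        rw [show buStep s (false, (k, i)) = (true, (k, i)) by simp [buStep, h], foldl_buStep_true, if_pos hlt, if_pos h,
          Nat.add_zero]
      · rw [show buStep s (false, (k, i)) = (false, (k + 1, i - s)) by simp [buStep, h], foldl_buStep rest (k + 1) (i - s),
          if_neg h]
        by_cases h' : i - s < rest.sum
        · have hlt : i < s + rest.sum := by omega
          rw [if_pos h', if_pos hlt, Nat.add_assoc, Nat.add_comm 1]
        · have hnlt : ¬ i < s + rest.sum := by omega
          rw [if_neg h', if_neg hnlt, Nat.add_assoc, Nat.add_comm 1, Nat.sub_sub]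

/-- Block unranking by the scan (the program form of `BudgetRegion.blockUnrank`). [folklore] -/
def blockUnrankL (sizes : List ℕ) (i : ℕ) : ℕ × ℕ := (sizes.foldl (fun st s => buStep s st) (false, (0, i))).2

/-- **The scan is block unranking.** [folklore] -/
theorem blockUnrankL_eq (sizes : List ℕ) (i : ℕ) : blockUnrankL sizes i = BudgetRegion.blockUnrank sizes i := by
  rw [blockUnrankL, foldl_buStep]
  split_ifs with h
  · simp
  · rw [blockUnrank_of_sum_le sizes i (not_lt.1 h), Nat.zero_add]

/-- The code of the scan state. [folklore] -/
abbrev buE : Bool × (ℕ × ℕ) → List Bool := pairE bitE (pairE natE natE)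

/-- **Block unranking on codes**: `(i, sizes) ↦ blockUnrankL sizes i`. [cite: AroraBarak2009, §1.3] -/
theorem blockUnrankLFP : CodeFP (pairE natE (rawE natE)) (pairE natE natE) (fun p => blockUnrankL p.2 p.1) := by
  let cE : ℕ × (ℕ × (Bool × (ℕ × ℕ))) → List Bool := pairE natE (pairE natE buE)
  have hs : CodeFP cE natE (fun t => t.2.1) := (snd _ _).fst'
  have hst : CodeFP cE buE (fun t => t.2.2) := (snd _ _).snd'
  have hflag : CodeFP cE bitE (fun t => t.2.2.1) := hst.fst'
  have hk : CodeFP cE natE (fun t => t.2.2.2.1) := hst.snd'.fst'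
  have hi : CodeFP cE natE (fun t => t.2.2.2.2) := hst.snd'.snd'
  have hfound : CodeFP cE buE (fun t => (true, t.2.2.2)) := (const _ true).pair hst.snd'
  have hskip : CodeFP cE buE (fun t => (false, (t.2.2.2.1 + 1, t.2.2.2.2 - t.2.1))) :=
    (const _ false).pair ((natAdd.comp (hk.pair (const _ 1))).pair (natSub.comp (hi.pair hs)))
  have hstep : CodeFP cE buE (fun t => buStep t.2.1 t.2.2) :=
    (hflag.ite hst ((natLt.comp (hi.pair hs)).ite hfound hskip)).congr fun t => by
      simp only [buStep, decide_eq_true_eq]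
  have h := foldl (step := fun (_ : ℕ) (s : ℕ) st => buStep s st) (init := fun i => (false, ((0 : ℕ), i))) hstep
    ((const _ false).pair ((const _ (0 : ℕ)).pair (CodeFP.id natE))) (3 * X + 6) (fun i l₁ l₂ => by
      rw [foldl_buStep]
      set L := (pairE natE (rawE natE) (i, l₁ ++ l₂)).length with hL
      have hLeq : L = 2 * Nat.size i + 2 + (rawE natE (l₁ ++ l₂)).length := by simp [hL, length_natE]
      have hraw := length_le_length_rawE natE (l₁ ++ l₂)
      rw [List.length_append] at hraw
      have hfst := blockUnrank_fst_le l₁ i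
      have hsnd := blockUnrank_snd_le l₁ i
      have hsz1 : Nat.size (BudgetRegion.blockUnrank l₁ i).1 ≤ L := by
        rw [Nat.size_le]; exact lt_of_le_of_lt (by omega) (Nat.lt_two_pow_self)
      have hsz2 : Nat.size (BudgetRegion.blockUnrank l₁ i).2 ≤ Nat.size i := size_mono hsnd
      have hsz3 : Nat.size l₁.length ≤ L := by
        rw [Nat.size_le]; exact lt_of_le_of_lt (by omega) (Nat.lt_two_pow_self)
      have hsz4 : Nat.size (i - l₁.sum) ≤ Nat.size i := size_mono (Nat.sub_le _ _)
      simp only [eval_add, eval_mul, eval_X, eval_ofNat]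
      split_ifs <;> simp [pairE_apply, length_boolPair, length_natE, bitE] <;> omega)
  exact (h.snd'.congr fun p => rfl :)

/-! ### Unranking as a program -/

/-- One coordinate of the unranking, on the state `(q, i, out)` (remaining budget, residual index,
coordinates found so far), reading row `t` of the reversed table: locate the band of `i`, divide
the offset by the fibre size. [folklore] -/
def unrankStep (Δ Q : ℕ) (T : List (List ℕ)) (t : ℕ) (st : ℕ × (ℕ × List ℤ)) : ℕ × (ℕ × List ℤ) :=
  (st.1 - bandLevel st.1 (blockUnrankL (bandTerms Δ Q st.1 (T.getD t [])) st.2.1).1,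
    ((blockUnrankL (bandTerms Δ Q st.1 (T.getD t [])) st.2.1).2 %
        (T.getD t []).getD (st.1 - bandLevel st.1 (blockUnrankL (bandTerms Δ Q st.1 (T.getD t [])) st.2.1).1) 0,
      st.2.2 ++ [bandStart Δ st.1 (blockUnrankL (bandTerms Δ Q st.1 (T.getD t [])) st.2.1).1 +
        (((blockUnrankL (bandTerms Δ Q st.1 (T.getD t [])) st.2.1).2 /
          (T.getD t []).getD (st.1 - bandLevel st.1 (blockUnrankL (bandTerms Δ Q st.1 (T.getD t [])) st.2.1).1) 0 : ℕ) : ℤ)]))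

/-- **The unranking program**: `n` steps of `unrankStep` over the reversed table of depth `n − 1`,
from `(Q, i, [])`; the output is the list of coordinates. [folklore] -/
def unrankList (Δ n Q i : ℕ) : List ℤ :=
  ((List.range n).foldl (fun st t => unrankStep Δ Q (tableRev Δ Q (n - 1)) t st) (Q, (i, []))).2.2

/-- `List.ofFn` of a consed vector. [folklore] -/
theorem ofFn_consV {m : ℕ} (v : ℤ) (y : Fin m → ℤ) : List.ofFn (consV v y) = v :: List.ofFn y := by
  rw [List.ofFn_succ]
  simp [consV]

/-- **Semantics of the unranking loop**: from step `n − m` on, with budget `q ≤ Q` and index `i`, the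
loop appends `List.ofFn (unrank Δ m q i)`. [folklore] -/
theorem foldl_unrankStep (Δ Q n : ℕ) : ∀ (m : ℕ), m ≤ n → ∀ {q : ℕ}, q ≤ Q → ∀ (i : ℕ) (out : List ℤ),
    ((List.range' (n - m) m).foldl (fun st t => unrankStep Δ Q (tableRev Δ Q (n - 1)) t st) (q, (i, out))).2.2 =
      out ++ List.ofFn (unrank Δ m q i)
  | 0, _, q, _, i, out => by simp
  | m + 1, hm, q, hq, i, out => by
      rw [List.range'_succ, List.foldl_cons, show n - (m + 1) + 1 = n - m from by omega]
      have hrow : (tableRev Δ Q (n - 1)).getD (n - (m + 1)) [] = rowOf Δ Q m := by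
        rw [tableRev_getD (by omega)]; congr 1; omega
      have hsizes : bandTerms Δ Q q (rowOf Δ Q m) = bandSizes Δ m q :=
        bandTerms_eq_bandSizes hq fun q' hq' => rowOf_getD Δ Q m (hq'.trans hq)
      have hbu : blockUnrankL (bandSizes Δ m q) i = bandOf Δ m q i := blockUnrankL_eq _ _
      have hstep : unrankStep Δ Q (tableRev Δ Q (n - 1)) (n - (m + 1)) (q, (i, out)) =
          (q - bandLevel q (bandOf Δ m q i).1, ((bandOf Δ m q i).2 % qCount Δ m (q - bandLevel q (bandOf Δ m q i).1),
            out ++ [bandStart Δ q (bandOf Δ m q i).1 +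
              (((bandOf Δ m q i).2 / qCount Δ m (q - bandLevel q (bandOf Δ m q i).1) : ℕ) : ℤ)])) := by
        simp only [unrankStep, hrow, hsizes, hbu, rowOf_getD Δ Q m (show q - bandLevel q (bandOf Δ m q i).1 ≤ Q by omega)]
      rw [hstep, foldl_unrankStep Δ Q n m (by omega) (show q - bandLevel q (bandOf Δ m q i).1 ≤ Q by omega),
        List.append_assoc, List.singleton_append, unrank_succ, ofFn_consV]

/-- **The unranking program is `unrank`.** [folklore] -/
theorem unrankList_eq (Δ n Q i : ℕ) : unrankList Δ n Q i = List.ofFn (unrank Δ n Q i) := by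
  have h := foldl_unrankStep Δ Q n n le_rfl le_rfl i []
  rwa [Nat.sub_self, ← List.range_eq_range', List.nil_append] at h

/-! ### Unranking on codes -/

/-- The band sizes list has at most `2q + 1` entries. [folklore] -/
theorem length_bandTerms_le (Δ Q q : ℕ) (row : List ℕ) : (bandTerms Δ Q q row).length ≤ 2 * q + 1 := by
  simp [bandTerms]

/-- The band sizes list has at most `2Q + 1` entries. [folklore] -/
theorem length_bandTerms_le' (Δ Q q : ℕ) (row : List ℕ) : (bandTerms Δ Q q row).length ≤ 2 * Q + 1 := by
  simp [bandTerms]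

/-- Band starts are small: `|bandStart Δ q k| ≤ bLev Δ q + 1` for `k ≤ 2q + 1`. [folklore] -/
theorem natAbs_bandStart_le (Δ q : ℕ) {k : ℕ} (hk : k ≤ 2 * q + 1) : (bandStart Δ q k).natAbs ≤ bLev Δ q + 1 := by
  unfold bandStart
  split_ifs with h
  · rw [Int.natAbs_neg, Int.natAbs_natCast]
    exact (bLev_mono Δ (Nat.sub_le q k)).trans (Nat.le_succ _)
  · have := bLev_mono Δ (show k - q - 1 ≤ q by omega)
    omega

/-- **One step keeps the state small**: the budget does not grow, the residual index does not grow,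
and the new coordinate is at most `bLev Δ Q + 1 + i` in absolute value. [folklore] -/
theorem unrankStep_inv (Δ Q : ℕ) (T : List (List ℕ)) (t : ℕ) {q : ℕ} (i : ℕ) (out : List ℤ) (hq : q ≤ Q) :
    (unrankStep Δ Q T t (q, (i, out))).1 ≤ q ∧ (unrankStep Δ Q T t (q, (i, out))).2.1 ≤ i ∧
      ∃ v : ℤ, (unrankStep Δ Q T t (q, (i, out))).2.2 = out ++ [v] ∧ v.natAbs ≤ bLev Δ Q + 1 + i := by
  simp only [unrankStep, blockUnrankL_eq]
  set sizes := bandTerms Δ Q q (T.getD t [])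
  set bu := BudgetRegion.blockUnrank sizes i
  have hoff : bu.2 ≤ i := blockUnrank_snd_le sizes i
  have hk : bu.1 ≤ 2 * q + 1 := (blockUnrank_fst_le sizes i).trans (length_bandTerms_le Δ Q q _)
  refine ⟨Nat.sub_le _ _, (Nat.mod_le _ _).trans hoff, _, rfl, ?_⟩
  refine (Int.natAbs_add_le _ _).trans ?_
  rw [Int.natAbs_natCast]
  have h1 := natAbs_bandStart_le Δ q hk
  have h2 := bLev_mono Δ hq
  have h3 : bu.2 / (T.getD t []).getD (q - bandLevel q bu.1) 0 ≤ bu.2 := Nat.div_le_self _ _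
  omega

/-- The unranking loop from an arbitrary state (program form). [folklore] -/
def unrankGo (Δ Q : ℕ) (T : List (List ℕ)) (l : List ℕ) (st : ℕ × (ℕ × List ℤ)) : ℕ × (ℕ × List ℤ) :=
  l.foldl (fun st t => unrankStep Δ Q T t st) st

/-- **The loop keeps the state small** (on every list of steps, for the accumulator bound). [folklore] -/
theorem unrankGo_inv (Δ Q : ℕ) (T : List (List ℕ)) (i₀ : ℕ) : ∀ (l : List ℕ) {q i : ℕ} {out : List ℤ},
    q ≤ Q → i ≤ i₀ → (∀ v ∈ out, v.natAbs ≤ bLev Δ Q + 1 + i₀) →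
    (unrankGo Δ Q T l (q, (i, out))).1 ≤ Q ∧ (unrankGo Δ Q T l (q, (i, out))).2.1 ≤ i₀ ∧
      (unrankGo Δ Q T l (q, (i, out))).2.2.length = out.length + l.length ∧
      ∀ v ∈ (unrankGo Δ Q T l (q, (i, out))).2.2, v.natAbs ≤ bLev Δ Q + 1 + i₀
  | [], q, i, out, hq, hi, hout => ⟨hq, hi, by simp [unrankGo], by simpa [unrankGo] using hout⟩
  | t :: l, q, i, out, hq, hi, hout => by
      obtain ⟨h1, h2, v, hv, hvb⟩ := unrankStep_inv Δ Q T t i out hq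
      have e : unrankGo Δ Q T (t :: l) (q, (i, out)) = unrankGo Δ Q T l (unrankStep Δ Q T t (q, (i, out))) := rfl
      set st := unrankStep Δ Q T t (q, (i, out)) with hst
      obtain ⟨q', i', out'⟩ := st
      simp only at h1 h2 hv
      subst hv
      obtain ⟨r1, r2, r3, r4⟩ := unrankGo_inv Δ Q T i₀ l (q := q') (i := i') (out := out ++ [v]) (h1.trans hq) (h2.trans hi)
        (fun w hw => by
          rw [List.mem_append, List.mem_singleton] at hw
          rcases hw with hw | rfl
          · exact hout w hw
          · omega)
      rw [e]
      exact ⟨r1, r2, by rw [r3]; simp; omega, r4⟩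

/-- Codes of the context `((1^Q, Δ), (i, T))`, of the state `(q, i, out)`. [folklore] -/
abbrev urCtxE : (ℕ × ℕ) × (ℕ × List (List ℕ)) → List Bool := pairE (pairE unE natE) (pairE natE (rawE (rawE natE)))

/-- The code of the unranking state `(q, i, out)`. [folklore] -/
abbrev urStE : ℕ × (ℕ × List ℤ) → List Bool := pairE natE (pairE natE (rawE intE))

/-- **One unranking step on codes.** [cite: AroraBarak2009, §1.3] -/
theorem unrankStepFP : CodeFP (pairE urCtxE (pairE natE urStE)) urStE
    (fun u => unrankStep u.1.1.2 u.1.1.1 u.1.2.2 u.2.1 u.2.2) := by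
  let rE : ((ℕ × ℕ) × (ℕ × List (List ℕ))) × (ℕ × (ℕ × (ℕ × List ℤ))) → List Bool := pairE urCtxE (pairE natE urStE)
  have hQ : CodeFP rE unE (fun u => u.1.1.1) := (fst _ _).fst'.fst'
  have hΔ : CodeFP rE natE (fun u => u.1.1.2) := (fst _ _).fst'.snd'
  have hT : CodeFP rE (rawE (rawE natE)) (fun u => u.1.2.2) := (fst _ _).snd'.snd'
  have ht : CodeFP rE natE (fun u => u.2.1) := (snd _ _).fst'
  have hq : CodeFP rE natE (fun u => u.2.2.1) := (snd _ _).snd'.fst'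
  have hi : CodeFP rE natE (fun u => u.2.2.2.1) := (snd _ _).snd'.snd'.fst'
  have hout : CodeFP rE (rawE intE) (fun u => u.2.2.2.2) := (snd _ _).snd'.snd'.snd'
  have hrow : CodeFP rE (rawE natE) (fun u => u.1.2.2.getD u.2.1 []) :=
    ((rawGetD (rawE natE) (d := ([] : List ℕ)) rfl).comp (hT.pair ht) :)
  have hsizes : CodeFP rE (rawE natE) (fun u => bandTerms u.1.1.2 u.1.1.1 u.2.2.1 (u.1.2.2.getD u.2.1 [])) :=
    (bandTermsFP.comp ((hQ.pair hΔ).pair (hq.pair hrow)) :)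
  have hbu : CodeFP rE (pairE natE natE)
      (fun u => blockUnrankL (bandTerms u.1.1.2 u.1.1.1 u.2.2.1 (u.1.2.2.getD u.2.1 [])) u.2.2.2.1) :=
    (blockUnrankLFP.comp (hi.pair hsizes) :)
  have hk := hbu.fst'
  have hoff := hbu.snd'
  have hlev : CodeFP rE natE (fun u => bandLevel u.2.2.1
      (blockUnrankL (bandTerms u.1.1.2 u.1.1.1 u.2.2.1 (u.1.2.2.getD u.2.1 [])) u.2.2.2.1).1) := (bandLevelFP.comp (hq.pair hk) :)
  have hq' := (natSub.comp (hq.pair hlev) :)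
  have hc : CodeFP rE natE (fun u => (u.1.2.2.getD u.2.1 []).getD (u.2.2.1 - bandLevel u.2.2.1
      (blockUnrankL (bandTerms u.1.1.2 u.1.1.1 u.2.2.1 (u.1.2.2.getD u.2.1 [])) u.2.2.2.1).1) 0) :=
    ((rawGetD natE (d := 0) rfl).comp (hrow.pair hq') :)
  have hi' := (natMod.comp (hoff.pair hc) :)
  have hv := (intAdd.comp ((bandStartFP.comp (hΔ.pair (hq.pair hk))).pair (intOfNat.comp (natDiv.comp (hoff.pair hc)))) :)
  have hout' := ((rawAppend intE).comp (hout.pair ((rawSingleton intE).comp hv)) :)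
  exact ((hq'.pair (hi'.pair hout')).congr fun u => rfl :)

/-- **The unranking loop on codes**: `(((1^Q, Δ), (i, T)), steps) ↦ unrankGo Δ Q T steps (Q, i, [])`; the
accumulator is polynomially bounded by `unrankGo_inv`. [cite: AroraBarak2009, §1.3] -/
theorem unrankGoFP : CodeFP (pairE urCtxE (rawE natE)) urStE
    (fun p => unrankGo p.1.1.2 p.1.1.1 p.1.2.2 p.2 (p.1.1.1, (p.1.2.1, []))) := by
  have hinit : CodeFP urCtxE urStE (fun s => (s.1.1, (s.2.1, ([] : List ℤ)))) :=
    ((natOfUn.comp (fst _ _).fst').pair ((snd _ _).fst'.pair (const _ ([] : List ℤ)))).congr fun _ => rfl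
  have h := foldl (step := fun (s : (ℕ × ℕ) × (ℕ × List (List ℕ))) (t : ℕ) st => unrankStep s.1.2 s.1.1 s.2.2 t st)
    (init := fun s => (s.1.1, (s.2.1, ([] : List ℤ)))) unrankStepFP hinit (X * (6 * X + 18) + 4 * X + 4)
    (fun s l₁ l₂ => by
      obtain ⟨⟨Q, Δ⟩, i₀, T⟩ := s
      obtain ⟨r1, r2, r3, r4⟩ := unrankGo_inv Δ Q T i₀ l₁ (q := Q) (i := i₀) (out := []) le_rfl le_rfl (by simp)
      have e : l₁.foldl (fun st t => unrankStep Δ Q T t st) (Q, (i₀, [])) = unrankGo Δ Q T l₁ (Q, (i₀, [])) := rfl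
      rw [e]
      set r := unrankGo Δ Q T l₁ (Q, (i₀, [])) with hr
      set L := (pairE urCtxE (rawE natE) (((Q, Δ), (i₀, T)), l₁ ++ l₂)).length with hL
      have hLeq : L = 2 * (2 * (2 * Q + 2 + Nat.size Δ) + 2 + (2 * Nat.size i₀ + 2 + (rawE (rawE natE) T).length)) + 2 +
          (rawE natE (l₁ ++ l₂)).length := by
        simp [hL, length_natE]
      have hraw := length_le_length_rawE natE (l₁ ++ l₂)
      rw [List.length_append] at hraw
      have hl₁ : l₁.length ≤ L := by omega
      -- size of the coordinates
      have hB : Nat.size (bLev Δ Q + 1 + i₀) ≤ L + 2 := by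
        have h1 := size_add_le (bLev Δ Q + 1) i₀
        have h2 : Nat.size (bLev Δ Q + 1) ≤ Nat.size (2 * bLev Δ Q + 1) := size_mono (by omega)
        have h3 := size_two_mul_bLev_succ_le Δ Q
        have h4 : max (Nat.size (bLev Δ Q + 1)) (Nat.size i₀) ≤ L + 1 := max_le (by omega) (by omega)
        omega
      have hitem : ∀ v ∈ r.2.2, (intE v).length ≤ 3 * (L + 2) + 2 := fun v hv =>
        (length_dpEnc_le v).trans (by have := size_mono (r4 v hv); nlinarith)
      have hout := length_rawE_le_of_forall intE hitem
      rw [r3, List.length_nil, Nat.zero_add] at hout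
      have hq : Nat.size r.1 ≤ L := by
        have := size_mono r1
        have : Nat.size Q ≤ Q := by rw [Nat.size_le]; exact Nat.lt_two_pow_self
        omega
      have hi : Nat.size r.2.1 ≤ L := by have := size_mono r2; omega
      simp only [urStE, pairE_apply, length_boolPair, length_natE, eval_add, eval_mul, eval_X, eval_ofNat]
      have hout' : (rawE intE r.2.2).length ≤ L * (6 * L + 18) :=
        hout.trans ((Nat.mul_le_mul hl₁ (by omega : 2 * (3 * (L + 2) + 2) + 2 ≤ 6 * L + 18)))
      omega)
  exact h.congr fun _ => rfl

/-- The code of the input `(1ⁿ, 1^Q, Δ, i)` of the unranking. [folklore] -/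
abbrev urInE : ℕ × (ℕ × (ℕ × ℕ)) → List Bool := pairE unE (pairE unE (pairE natE natE))

/-- **Unranking the quantised ball is polynomial time**: `(1ⁿ, 1^Q, bin Δ, bin i) ↦ (unrank Δ n Q i)` as
the raw list of its `n` integer coordinates (`= nthLex (qBall n Q Δ) i` for `i < |qBall n Q Δ|`, `Δ ≥ 1`,
by `unrank_eq_nthLex`; the points of `pointSet n Q Δ` for `i < 2^κ`, `pointSet_eq_image_unrank`).
[cite: Regev2004, Lemma 3.11 (preparation of the state over the grid points of a ball; exact variant)] -/
theorem unrankFP : CodeFP urInE (rawE intE) (fun a => List.ofFn (unrank a.2.2.1 a.1 a.2.1 a.2.2.2)) := by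
  have hn : CodeFP urInE unE (fun a => a.1) := fst _ _
  have hQ : CodeFP urInE unE (fun a => a.2.1) := (snd _ _).fst'
  have hΔ : CodeFP urInE natE (fun a => a.2.2.1) := (snd _ _).snd'.fst'
  have hi : CodeFP urInE natE (fun a => a.2.2.2) := (snd _ _).snd'.snd'
  -- `1^{n-1}` as `min (n - 1) n`
  have hn1 : CodeFP urInE unE (fun a => min (a.1 - 1) a.1) :=
    (unOfNatMin.comp (hn.pair (natSub.comp ((natOfUn.comp hn).pair (const _ 1)))) :)
  have hT : CodeFP urInE (rawE (rawE natE)) (fun a => tableRev a.2.2.1 a.2.1 (min (a.1 - 1) a.1)) :=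
    (tableRevFP.comp (hn1.pair (hQ.pair hΔ)) :)
  have hctx : CodeFP urInE urCtxE (fun a => ((a.2.1, a.2.2.1), (a.2.2.2, tableRev a.2.2.1 a.2.1 (min (a.1 - 1) a.1)))) :=
    (hQ.pair hΔ).pair (hi.pair hT)
  have hsteps : CodeFP urInE (rawE natE) (fun a => List.range a.1) := urange.comp hn
  refine ((unrankGoFP.comp (hctx.pair hsteps)).snd'.snd'.congr fun a => ?_)
  obtain ⟨n, Q, Δ, i⟩ := a
  simp only
  rw [min_eq_left (Nat.sub_le n 1), ← unrankList_eq]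
  rfl

/-! ### Ranking as a program -/

/-- One coordinate of the ranking, on the state `(q, acc)` (remaining budget, partial rank), reading
row `t` of the reversed table and coordinate `t` of the vector: add the sizes of the earlier bands and
the offset times the fibre size. [folklore] -/
def rankStep (Δ Q : ℕ) (T : List (List ℕ)) (xs : List ℤ) (t : ℕ) (st : ℕ × ℕ) : ℕ × ℕ :=
  (st.1 - qWeight Δ (xs.getD t 0),
    st.2 + (((bandTerms Δ Q st.1 (T.getD t [])).take (min (bandIdx Δ st.1 (xs.getD t 0)) (2 * Q + 1))).sum +
      bandOff Δ st.1 (xs.getD t 0) * (T.getD t []).getD (st.1 - qWeight Δ (xs.getD t 0)) 0))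

/-- The ranking loop from an arbitrary state (program form). [folklore] -/
def rankGo (Δ Q : ℕ) (T : List (List ℕ)) (xs : List ℤ) (l : List ℕ) (st : ℕ × ℕ) : ℕ × ℕ :=
  l.foldl (fun st t => rankStep Δ Q T xs t st) st

/-- **The ranking program**: `n` steps over the reversed table of depth `n − 1`, from `(Q, 0)`. [folklore] -/
def rankList (Δ n Q : ℕ) (xs : List ℤ) : ℕ := (rankGo Δ Q (tableRev Δ Q (n - 1)) xs (List.range n) (Q, 0)).2

/-- Capping the count of a `take` by a bound on the length changes nothing. [folklore] -/
theorem take_min_of_length_le {α : Type} (l : List α) {k B : ℕ} (h : l.length ≤ B) : l.take (min k B) = l.take k := by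
  rcases le_total k B with hk | hk
  · rw [min_eq_left hk]
  · rw [min_eq_right hk, List.take_of_length_le h, List.take_of_length_le (h.trans hk)]

/-- **Semantics of the ranking loop**: from step `n − m` on, with budget `q ≤ Q`, the loop adds
`rank Δ m q` of the remaining coordinates. [folklore] -/
theorem rankGo_range' (Δ Q n : ℕ) (xs : List ℤ) : ∀ (m : ℕ), m ≤ n → ∀ {q : ℕ}, q ≤ Q → ∀ (acc : ℕ),
    (rankGo Δ Q (tableRev Δ Q (n - 1)) xs (List.range' (n - m) m) (q, acc)).2 =
      acc + rank Δ m q (fun j => xs.getD (n - m + j) 0)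
  | 0, _, q, _, acc => by simp [rankGo, rank]
  | m + 1, hm, q, hq, acc => by
      rw [rankGo, List.range'_succ, List.foldl_cons, show n - (m + 1) + 1 = n - m from by omega]
      have hrow : (tableRev Δ Q (n - 1)).getD (n - (m + 1)) [] = rowOf Δ Q m := by
        rw [tableRev_getD (by omega)]; congr 1; omega
      have hsizes : bandTerms Δ Q q (rowOf Δ Q m) = bandSizes Δ m q :=
        bandTerms_eq_bandSizes hq fun q' hq' => rowOf_getD Δ Q m (hq'.trans hq)
      set v := xs.getD (n - (m + 1)) 0 with hv
      have hlen : (bandSizes Δ m q).length ≤ 2 * Q + 1 := by simp [bandSizes]; omega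
      have hstep : rankStep Δ Q (tableRev Δ Q (n - 1)) xs (n - (m + 1)) (q, acc) =
          (q - qWeight Δ v, acc + (((bandSizes Δ m q).take (bandIdx Δ q v)).sum +
            bandOff Δ q v * qCount Δ m (q - qWeight Δ v))) := by
        simp only [rankStep, hrow, hsizes, ← hv, take_min_of_length_le _ hlen, rowOf_getD Δ Q m (Nat.sub_le q (qWeight Δ v) |>.trans hq)]
      rw [hstep, show (List.range' (n - m) m).foldl (fun st t => rankStep Δ Q (tableRev Δ Q (n - 1)) xs t st)
          (q - qWeight Δ v, acc + (((bandSizes Δ m q).take (bandIdx Δ q v)).sum + bandOff Δ q v * qCount Δ m (q - qWeight Δ v))) =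
          rankGo Δ Q (tableRev Δ Q (n - 1)) xs (List.range' (n - m) m) _ from rfl,
        rankGo_range' Δ Q n xs m (by omega) (show q - qWeight Δ v ≤ Q from (Nat.sub_le _ _).trans hq), rank_succ]
      have htail : (Fin.tail fun j : Fin (m + 1) => xs.getD (n - (m + 1) + (j : ℕ)) 0) = fun j : Fin m => xs.getD (n - m + (j : ℕ)) 0 := by
        funext j
        simp only [Fin.tail, Fin.val_succ]
        congr 1
        omega
      rw [htail]
      simp only [Fin.val_zero, Nat.add_zero, ← hv]
      ring

/-- **The ranking program is `rank`.** [folklore] -/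
theorem rankList_eq (Δ n Q : ℕ) (xs : List ℤ) : rankList Δ n Q xs = rank Δ n Q (fun j => xs.getD j 0) := by
  have h := rankGo_range' Δ Q n xs n le_rfl le_rfl 0
  rw [Nat.sub_self, ← List.range_eq_range', Nat.zero_add] at h
  rw [rankList, h]
  simp

/-! ### Value bounds for the ranking loop -/

/-- `⌈v²/Δ⌉ ≤ v² + Δ` (all `Δ`). [folklore] -/
theorem qWeight_le_sq_add (Δ : ℕ) (v : ℤ) : qWeight Δ v ≤ v.natAbs ^ 2 + Δ := by
  unfold qWeight
  exact (Nat.div_le_self _ _).trans (by omega)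

/-- The band index is at most `q + ⌈v²/Δ⌉`. [folklore] -/
theorem bandIdx_le (Δ q : ℕ) (v : ℤ) : bandIdx Δ q v ≤ q + qWeight Δ v := by
  unfold bandIdx; split_ifs <;> omega

/-- Band starts, crudely: `|bandStart Δ q k| ≤ bLev Δ (q + k) + 1`. [folklore] -/
theorem natAbs_bandStart_le_add (Δ q k : ℕ) : (bandStart Δ q k).natAbs ≤ bLev Δ (q + k) + 1 := by
  unfold bandStart
  split_ifs with h
  · rw [Int.natAbs_neg, Int.natAbs_natCast]
    exact (bLev_mono Δ (show q - k ≤ q + k by omega)).trans (Nat.le_succ _)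
  · have := bLev_mono Δ (show k - q - 1 ≤ q + k by omega)
    omega

/-- `bLev Δ j ≤ jΔ`. [folklore] -/
theorem bLev_le_mul (Δ j : ℕ) : bLev Δ j ≤ j * Δ := Nat.sqrt_le_self _

/-- The offset is at most `|v| + |bandStart|`. [folklore] -/
theorem bandOff_le (Δ q : ℕ) (v : ℤ) : bandOff Δ q v ≤ v.natAbs + (bandStart Δ q (bandIdx Δ q v)).natAbs := by
  unfold bandOff; omega

/-- `bandLen Δ j ≤ bLev Δ j + 1`. [folklore] -/
theorem bandLen_le (Δ j : ℕ) : bandLen Δ j ≤ bLev Δ j + 1 := by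
  unfold bandLen; split_ifs <;> omega

/-- `bandLevel q k ≤ q + k`. [folklore] -/
theorem bandLevel_le_add (q k : ℕ) : bandLevel q k ≤ q + k := by
  unfold bandLevel; omega

/-- A `getD` with default `0` is bounded by a bound on the items. [folklore] -/
theorem getD_le_of_forall {row : List ℕ} {C : ℕ} (hC : ∀ c ∈ row, c ≤ C) (j : ℕ) : row.getD j 0 ≤ C := by
  by_cases hj : j < row.length
  · rw [List.getD_eq_getElem _ _ hj]; exact hC _ (List.getElem_mem hj)
  · rw [List.getD_eq_default _ _ (not_lt.1 hj)]; exact Nat.zero_le _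

/-- Items of a `getD` row with default `[]` inherit a bound on all rows. [folklore] -/
theorem forall_mem_getD {T : List (List ℕ)} {C : ℕ} (hT : ∀ row ∈ T, ∀ c ∈ row, c ≤ C) (t : ℕ) :
    ∀ c ∈ T.getD t [], c ≤ C := by
  by_cases ht : t < T.length
  · rw [List.getD_eq_getElem _ _ ht]; exact hT _ (List.getElem_mem ht)
  · rw [List.getD_eq_default _ _ (not_lt.1 ht)]; simp

/-- One band size is at most `(bLev Δ (q + k) + 1) · C` for rows bounded by `C`. [folklore] -/
theorem bandTerm_le {Δ q : ℕ} {row : List ℕ} {C : ℕ} (hC : ∀ c ∈ row, c ≤ C) (k : ℕ) :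
    bandTerm Δ q row k ≤ (bLev Δ (q + k) + 1) * C := by
  unfold bandTerm
  refine Nat.mul_le_mul ((bandLen_le _ _).trans ?_) (getD_le_of_forall hC _)
  have := bLev_mono Δ (bandLevel_le_add q k)
  omega

/-- The band sizes of a level `q ≤ Q` add up to at most `(2Q + 1)(bLev Δ (3Q) + 1) C`. [folklore] -/
theorem sum_bandTerms_le {Δ Q q : ℕ} (hq : q ≤ Q) {row : List ℕ} {C : ℕ} (hC : ∀ c ∈ row, c ≤ C) :
    (bandTerms Δ Q q row).sum ≤ (2 * Q + 1) * ((bLev Δ (3 * Q) + 1) * C) := by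
  have hlen := length_bandTerms_le' Δ Q q row
  refine (List.sum_le_card_nsmul _ ((bLev Δ (3 * Q) + 1) * C) fun x hx => ?_).trans ?_
  · rw [bandTerms, List.mem_map] at hx
    obtain ⟨k, hk, rfl⟩ := hx
    rw [List.mem_range] at hk
    refine (bandTerm_le hC k).trans (Nat.mul_le_mul_right _ ?_)
    have := bLev_mono Δ (show q + k ≤ 3 * Q by omega)
    omega
  · rw [smul_eq_mul]
    exact Nat.mul_le_mul_right _ hlen

/-- **One ranking step keeps the state small**: the budget does not grow and the partial rank grows by
at most `18 M⁴` when `Q, Δ`, the table entries and the coordinates are at most `M ≥ 1`. [folklore] -/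
theorem rankStep_le {Δ Q M : ℕ} {T : List (List ℕ)} {xs : List ℤ} (hM : 1 ≤ M) (hQ : Q ≤ M) (hΔ : Δ ≤ M)
    (hT : ∀ row ∈ T, ∀ c ∈ row, c ≤ M) (hxs : ∀ v ∈ xs, v.natAbs ≤ M) (t : ℕ) {q : ℕ} (hq : q ≤ Q) (acc : ℕ) :
    (rankStep Δ Q T xs t (q, acc)).1 ≤ q ∧ (rankStep Δ Q T xs t (q, acc)).2 ≤ acc + 18 * M ^ 4 := by
  refine ⟨Nat.sub_le _ _, ?_⟩
  simp only [rankStep]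
  set row := T.getD t [] with hrow
  set v := xs.getD t 0 with hv
  have hrowC : ∀ c ∈ row, c ≤ M := forall_mem_getD hT t
  have hvM : v.natAbs ≤ M := by
    rw [hv]
    by_cases ht : t < xs.length
    · rw [List.getD_eq_getElem _ _ ht]; exact hxs _ (List.getElem_mem ht)
    · rw [List.getD_eq_default _ _ (not_lt.1 ht)]; simp
  -- the sum of the earlier bands
  have hA : ((bandTerms Δ Q q row).take (min (bandIdx Δ q v) (2 * Q + 1))).sum ≤ 12 * M ^ 4 := by
    refine (List.Sublist.sum_le_sum (List.take_sublist _ _) fun _ _ => Nat.zero_le _).trans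
      ((sum_bandTerms_le hq hrowC).trans ?_)
    have h1 : 2 * Q + 1 ≤ 3 * M := by omega
    have h2 : bLev Δ (3 * Q) + 1 ≤ 4 * M ^ 2 := by
      have := bLev_le_mul Δ (3 * Q)
      have : 3 * Q * Δ ≤ 3 * M * M := Nat.mul_le_mul (Nat.mul_le_mul_left 3 hQ) hΔ
      nlinarith
    calc (2 * Q + 1) * ((bLev Δ (3 * Q) + 1) * M) ≤ 3 * M * (4 * M ^ 2 * M) :=
          Nat.mul_le_mul h1 (Nat.mul_le_mul_right _ h2)
      _ = 12 * M ^ 4 := by ring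
  -- the offset times the fibre size
  have hB : bandOff Δ q v * row.getD (q - qWeight Δ v) 0 ≤ 6 * M ^ 4 := by
    have hc : row.getD (q - qWeight Δ v) 0 ≤ M := getD_le_of_forall hrowC _
    have hw : qWeight Δ v ≤ M ^ 2 + M := (qWeight_le_sq_add Δ v).trans (by
      have := Nat.pow_le_pow_left hvM 2; omega)
    have hk : q + bandIdx Δ q v ≤ M ^ 2 + 3 * M := by have := bandIdx_le Δ q v; omega
    have hs : (bandStart Δ q (bandIdx Δ q v)).natAbs ≤ 4 * M ^ 3 + 1 := by
      refine (natAbs_bandStart_le_add Δ q _).trans ?_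
      have h1 := bLev_le_mul Δ (q + bandIdx Δ q v)
      have h2 : (q + bandIdx Δ q v) * Δ ≤ (M ^ 2 + 3 * M) * M := Nat.mul_le_mul hk hΔ
      nlinarith
    have hoff : bandOff Δ q v ≤ 6 * M ^ 3 := by
      have := bandOff_le Δ q v
      nlinarith
    calc bandOff Δ q v * row.getD (q - qWeight Δ v) 0 ≤ 6 * M ^ 3 * M := Nat.mul_le_mul hoff hc
      _ = 6 * M ^ 4 := by ring
  omega

/-- **The ranking loop keeps the state small.** [folklore] -/
theorem rankGo_le {Δ Q M : ℕ} {T : List (List ℕ)} {xs : List ℤ} (hM : 1 ≤ M) (hQ : Q ≤ M) (hΔ : Δ ≤ M)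
    (hT : ∀ row ∈ T, ∀ c ∈ row, c ≤ M) (hxs : ∀ v ∈ xs, v.natAbs ≤ M) : ∀ (l : List ℕ) {q : ℕ}, q ≤ Q → ∀ acc : ℕ,
    (rankGo Δ Q T xs l (q, acc)).1 ≤ Q ∧ (rankGo Δ Q T xs l (q, acc)).2 ≤ acc + l.length * (18 * M ^ 4)
  | [], q, hq, acc => by simp [rankGo, hq]
  | t :: l, q, hq, acc => by
      obtain ⟨h1, h2⟩ := rankStep_le hM hQ hΔ hT hxs t hq acc
      have e : rankGo Δ Q T xs (t :: l) (q, acc) = rankGo Δ Q T xs l (rankStep Δ Q T xs t (q, acc)) := rfl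
      set st := rankStep Δ Q T xs t (q, acc) with hst
      obtain ⟨q', acc'⟩ := st
      simp only at h1 h2
      obtain ⟨r1, r2⟩ := rankGo_le hM hQ hΔ hT hxs l (h1.trans hq) acc'
      rw [e]
      refine ⟨r1, r2.trans ?_⟩
      rw [List.length_cons]
      nlinarith

/-! ### Ranking on codes -/

/-- Codes of the context `((1^Q, Δ), (T, xs))` of the ranking loop. [folklore] -/
abbrev rkCtxE : (ℕ × ℕ) × (List (List ℕ) × List ℤ) → List Bool :=
  pairE (pairE unE natE) (pairE (rawE (rawE natE)) (rawE intE))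

/-- `(Δ, q, v) ↦ bandIdx Δ q v`. [folklore] -/
theorem bandIdxFP : CodeFP (pairE natE (pairE natE intE)) natE (fun p => bandIdx p.1 p.2.1 p.2.2) := by
  let cE : ℕ × (ℕ × ℤ) → List Bool := pairE natE (pairE natE intE)
  have hw : CodeFP cE natE (fun p => qWeight p.1 p.2.2) := (qWeightFP.comp ((fst _ _).pair (snd _ _).snd') :)
  have hq : CodeFP cE natE (fun p => p.2.1) := (snd _ _).fst'
  refine (((intLt.comp ((snd _ _).snd'.pair (const _ (0 : ℤ)))).ite (natSub.comp (hq.pair hw)) (natAdd.comp (hq.pair hw))).congr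
    fun p => ?_)
  simp only [bandIdx, decide_eq_true_eq]

/-- `(Δ, q, v) ↦ bandOff Δ q v`. [folklore] -/
theorem bandOffFP : CodeFP (pairE natE (pairE natE intE)) natE (fun p => bandOff p.1 p.2.1 p.2.2) := by
  let cE : ℕ × (ℕ × ℤ) → List Bool := pairE natE (pairE natE intE)
  have hs : CodeFP cE intE (fun p => bandStart p.1 p.2.1 (bandIdx p.1 p.2.1 p.2.2)) :=
    (bandStartFP.comp ((fst _ _).pair ((snd _ _).fst'.pair bandIdxFP)) :)
  exact ((intToNat.comp (intSub.comp ((snd _ _).snd'.pair hs))).congr fun _ => rfl :)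

/-- **One ranking step on codes.** [cite: AroraBarak2009, §1.3] -/
theorem rankStepFP : CodeFP (pairE rkCtxE (pairE natE (pairE natE natE))) (pairE natE natE)
    (fun u => rankStep u.1.1.2 u.1.1.1 u.1.2.1 u.1.2.2 u.2.1 u.2.2) := by
  let rE : ((ℕ × ℕ) × (List (List ℕ) × List ℤ)) × (ℕ × (ℕ × ℕ)) → List Bool := pairE rkCtxE (pairE natE (pairE natE natE))
  have hQ : CodeFP rE unE (fun u => u.1.1.1) := (fst _ _).fst'.fst'
  have hΔ : CodeFP rE natE (fun u => u.1.1.2) := (fst _ _).fst'.snd'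
  have hT : CodeFP rE (rawE (rawE natE)) (fun u => u.1.2.1) := (fst _ _).snd'.fst'
  have hxs : CodeFP rE (rawE intE) (fun u => u.1.2.2) := (fst _ _).snd'.snd'
  have ht : CodeFP rE natE (fun u => u.2.1) := (snd _ _).fst'
  have hq : CodeFP rE natE (fun u => u.2.2.1) := (snd _ _).snd'.fst'
  have hacc : CodeFP rE natE (fun u => u.2.2.2) := (snd _ _).snd'.snd'
  have hrow : CodeFP rE (rawE natE) (fun u => u.1.2.1.getD u.2.1 []) :=
    ((rawGetD (rawE natE) (d := ([] : List ℕ)) rfl).comp (hT.pair ht) :)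
  have hv : CodeFP rE intE (fun u => u.1.2.2.getD u.2.1 0) := ((rawGetOr intE).comp (hxs.pair (ht.pair (const _ (0 : ℤ)))) :)
  have hw : CodeFP rE natE (fun u => qWeight u.1.1.2 (u.1.2.2.getD u.2.1 0)) := (qWeightFP.comp (hΔ.pair hv) :)
  have hq' := (natSub.comp (hq.pair hw) :)
  have hsizes : CodeFP rE (rawE natE) (fun u => bandTerms u.1.1.2 u.1.1.1 u.2.2.1 (u.1.2.1.getD u.2.1 [])) :=
    (bandTermsFP.comp ((hQ.pair hΔ).pair (hq.pair hrow)) :)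
  have hk : CodeFP rE natE (fun u => bandIdx u.1.1.2 u.2.2.1 (u.1.2.2.getD u.2.1 0)) := (bandIdxFP.comp (hΔ.pair (hq.pair hv)) :)
  have hbud : CodeFP rE unE (fun u => u.1.1.1 + u.1.1.1 + 1) := (unSucc.comp (unAdd.comp (hQ.pair hQ)) :)
  have hku : CodeFP rE unE (fun u => min (bandIdx u.1.1.2 u.2.2.1 (u.1.2.2.getD u.2.1 0)) (u.1.1.1 + u.1.1.1 + 1)) :=
    (unOfNatMin.comp (hbud.pair hk) :)
  have htake := ((rawTakeUn natE).comp (hku.pair hsizes) :)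
  have hA := (natSumFP.comp htake :)
  have hoff : CodeFP rE natE (fun u => bandOff u.1.1.2 u.2.2.1 (u.1.2.2.getD u.2.1 0)) := (bandOffFP.comp (hΔ.pair (hq.pair hv)) :)
  have hc := ((rawGetD natE (d := 0) rfl).comp (hrow.pair hq') :)
  have hB := (natMul.comp (hoff.pair hc) :)
  have hacc' := (natAdd.comp (hacc.pair (natAdd.comp (hA.pair hB))) :)
  refine ((hq'.pair hacc').congr fun u => ?_ :)
  simp only [rankStep, two_mul]

/-- **The ranking loop on codes**; the accumulator is polynomially bounded by `rankGo_le`. [cite: AroraBarak2009, §1.3] -/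
theorem rankGoFP : CodeFP (pairE rkCtxE (rawE natE)) (pairE natE natE)
    (fun p => rankGo p.1.1.2 p.1.1.1 p.1.2.1 p.1.2.2 p.2 (p.1.1.1, 0)) := by
  have hinit : CodeFP rkCtxE (pairE natE natE) (fun s => (s.1.1, (0 : ℕ))) :=
    ((natOfUn.comp (fst _ _).fst').pair (const _ (0 : ℕ))).congr fun _ => rfl
  have h := foldl (step := fun (s : (ℕ × ℕ) × (List (List ℕ) × List ℤ)) (t : ℕ) st => rankStep s.1.2 s.1.1 s.2.1 s.2.2 t st)
    (init := fun s => (s.1.1, (0 : ℕ))) rankStepFP hinit (7 * X + 9)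
    (fun s l₁ l₂ => by
      obtain ⟨⟨Q, Δ⟩, T, xs⟩ := s
      set L := (pairE rkCtxE (rawE natE) (((Q, Δ), (T, xs)), l₁ ++ l₂)).length with hL
      have hLeq : L = 2 * (2 * (2 * Q + 2 + Nat.size Δ) + 2 + (2 * (rawE (rawE natE) T).length + 2 + (rawE intE xs).length)) + 2 +
          (rawE natE (l₁ ++ l₂)).length := by
        simp [hL, length_natE]
      have hraw := length_le_length_rawE natE (l₁ ++ l₂)
      rw [List.length_append] at hraw
      have hl₁ : l₁.length ≤ L := by omega
      -- everything is below `M = 2^L`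
      set M := 2 ^ L with hM
      have hM1 : 1 ≤ M := Nat.one_le_two_pow
      have hLM : L < M := Nat.lt_two_pow_self
      have hQM : Q ≤ M := by omega
      have hΔM : Δ ≤ M := by
        have := Nat.lt_size_self Δ
        exact (this.trans_le (Nat.pow_le_pow_right (by norm_num) (by omega))).le
      have hTM : ∀ row ∈ T, ∀ c ∈ row, c ≤ M := fun row hrow c hc => by
        have h1 := length_item_le_length_rawE natE hc
        have h2 := length_item_le_length_rawE (rawE natE) hrow
        have h3 := Nat.lt_size_self c
        rw [← length_natE] at h3
        exact (h3.trans_le (Nat.pow_le_pow_right (by norm_num) (by omega))).le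
      have hxsM : ∀ v ∈ xs, v.natAbs ≤ M := fun v hv => by
        have h1 := length_item_le_length_rawE intE hv
        have h2 := size_natAbs_le_length_intE v
        have h3 := Nat.lt_size_self v.natAbs
        exact (h3.trans_le (Nat.pow_le_pow_right (by norm_num) (by omega))).le
      have e : l₁.foldl (fun st t => rankStep Δ Q T xs t st) (Q, 0) = rankGo Δ Q T xs l₁ (Q, 0) := rfl
      rw [e]
      obtain ⟨r1, r2⟩ := rankGo_le hM1 hQM hΔM hTM hxsM l₁ le_rfl 0
      set r := rankGo Δ Q T xs l₁ (Q, 0)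
      have hq : Nat.size r.1 ≤ L := by
        have := size_mono r1
        have : Nat.size Q ≤ Q := by rw [Nat.size_le]; exact Nat.lt_two_pow_self
        omega
      have hacc : Nat.size r.2 ≤ 5 * L + 5 := by
        rw [Nat.size_le]
        have h1 : r.2 ≤ L * (18 * M ^ 4) := by
          have := r2
          rw [Nat.zero_add] at this
          exact this.trans (Nat.mul_le_mul_right _ hl₁)
        have h2 : L * (18 * M ^ 4) ≤ M * (18 * M ^ 4) := Nat.mul_le_mul_right _ hLM.le
        have hM4 : 0 < M ^ 4 := by positivity
        have h3 : M * (18 * M ^ 4) < M * (32 * M ^ 4) := Nat.mul_lt_mul_of_pos_left (by omega) (by omega)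
        have h4 : M * (32 * M ^ 4) = 2 ^ (5 * L + 5) := by
          rw [hM]
          ring
        calc r.2 ≤ L * (18 * M ^ 4) := h1
          _ < 2 ^ (5 * L + 5) := by rw [← h4]; exact lt_of_le_of_lt h2 h3
      simp only [pairE_apply, length_boolPair, length_natE, eval_add, eval_mul, eval_X, eval_ofNat]
      omega)
  exact h.congr fun _ => rfl

/-- The code of the input `(1ⁿ, 1^Q, Δ, x)` of the ranking (`x` as the raw list of its coordinates). [folklore] -/
abbrev rkInE : ℕ × (ℕ × (ℕ × List ℤ)) → List Bool := pairE unE (pairE unE (pairE natE (rawE intE)))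

/-- **Ranking the quantised ball is polynomial time**: `(1ⁿ, 1^Q, bin Δ, x) ↦ rank Δ n Q x` (the
lexicographic rank of `x ∈ qBall n Q Δ`, `rank_eq_lexRank`; the inverse of `unrank`, `rank_unrank` /
`unrank_rank`), reading coordinate `j < n` of `x` as `x.getD j 0`.
[cite: Regev2004, Lemma 3.12 (proof: the index register of the prepared state must be erased; exact variant)] -/
theorem rankFP : CodeFP rkInE natE (fun a => rank a.2.2.1 a.1 a.2.1 fun j => a.2.2.2.getD j 0) := by
  have hn : CodeFP rkInE unE (fun a => a.1) := fst _ _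
  have hQ : CodeFP rkInE unE (fun a => a.2.1) := (snd _ _).fst'
  have hΔ : CodeFP rkInE natE (fun a => a.2.2.1) := (snd _ _).snd'.fst'
  have hxs : CodeFP rkInE (rawE intE) (fun a => a.2.2.2) := (snd _ _).snd'.snd'
  have hn1 : CodeFP rkInE unE (fun a => min (a.1 - 1) a.1) :=
    (unOfNatMin.comp (hn.pair (natSub.comp ((natOfUn.comp hn).pair (const _ 1)))) :)
  have hT : CodeFP rkInE (rawE (rawE natE)) (fun a => tableRev a.2.2.1 a.2.1 (min (a.1 - 1) a.1)) :=
    (tableRevFP.comp (hn1.pair (hQ.pair hΔ)) :)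
  have hctx : CodeFP rkInE rkCtxE (fun a => ((a.2.1, a.2.2.1), (tableRev a.2.2.1 a.2.1 (min (a.1 - 1) a.1), a.2.2.2))) :=
    (hQ.pair hΔ).pair (hT.pair hxs)
  have hsteps : CodeFP rkInE (rawE natE) (fun a => List.range a.1) := urange.comp hn
  refine ((rankGoFP.comp (hctx.pair hsteps)).snd'.congr fun a => ?_)
  obtain ⟨n, Q, Δ, xs⟩ := a
  simp only
  rw [min_eq_left (Nat.sub_le n 1), ← rankList_eq]
  rfl

/-! ### The membership test of the point set on codes -/

/-- The quantised weight of a coded vector: `(Δ, x, 1ⁿ) ↦ ∑_{j<n} ⌈x_j²/Δ⌉`. [folklore] -/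
theorem sumQWeightFP : CodeFP (pairE natE (pairE (rawE intE) unE)) natE
    (fun p => ((List.range p.2.2).map fun j => qWeight p.1 (p.2.1.getD j 0)).sum) := by
  let cE : ℕ × (List ℤ × ℕ) → List Bool := pairE natE (pairE (rawE intE) unE)
  have hitem : CodeFP (pairE cE natE) natE (fun t => qWeight t.1.1 (t.1.2.1.getD t.2 0)) :=
    (qWeightFP.comp ((fst _ _).fst'.pair ((rawGetOr intE).comp ((fst _ _).snd'.fst'.pair ((snd _ _).pair
      (const _ (0 : ℤ)))))) :)
  exact ((natSumFP.comp ((map hitem).comp ((CodeFP.id cE).pair (urange.comp (snd _ _).snd')))).congr fun _ => rfl :)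

/-- The quantised weight of a vector read off a list is the sum over `range n`. [folklore] -/
theorem sum_qWeight_getD (Δ n : ℕ) (xs : List ℤ) :
    ∑ j : Fin n, qWeight Δ (xs.getD j 0) = ((List.range n).map fun j => qWeight Δ (xs.getD j 0)).sum := by
  rw [Fin.sum_univ_eq_sum_range (fun j => qWeight Δ (xs.getD j 0)) n]
  induction n with
  | zero => simp
  | succ n ih => rw [Finset.sum_range_succ, ih, List.range_succ, List.map_append, List.sum_append]; simp

/-- **The membership test of the point set is polynomial time**: `(1ⁿ, 1^Q, bin Δ, x) ↦
[∑_{j<n} ⌈x_j²/Δ⌉ ≤ Q ∧ rank Δ n Q x < 2^{⌊log₂ qCount Δ n Q⌋}]`, i.e. `[x ∈ pointSet n Q Δ]` for a vector of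
`n` coordinates (`decide_memPointSet_iff`). [cite: Regev2004, Lemma 3.12 (proof: the test whether a recomputed point is a point of the register's set; exact variant)] -/
theorem memPointSetFP : CodeFP rkInE bitE (fun a => decide
    ((∑ j : Fin a.1, qWeight a.2.2.1 (a.2.2.2.getD j 0)) ≤ a.2.1 ∧
      rank a.2.2.1 a.1 a.2.1 (fun j => a.2.2.2.getD j 0) < 2 ^ Nat.log 2 (qCount a.2.2.1 a.1 a.2.1))) := by
  have hn : CodeFP rkInE unE (fun a => a.1) := fst _ _
  have hQ : CodeFP rkInE unE (fun a => a.2.1) := (snd _ _).fst'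
  have hΔ : CodeFP rkInE natE (fun a => a.2.2.1) := (snd _ _).snd'.fst'
  have hxs : CodeFP rkInE (rawE intE) (fun a => a.2.2.2) := (snd _ _).snd'.snd'
  have hw : CodeFP rkInE natE (fun a => ((List.range a.1).map fun j => qWeight a.2.2.1 (a.2.2.2.getD j 0)).sum) :=
    (sumQWeightFP.comp (hΔ.pair (hxs.pair hn)) :)
  have h1 : CodeFP rkInE bitE (fun a => decide (((List.range a.1).map fun j => qWeight a.2.2.1 (a.2.2.2.getD j 0)).sum ≤ a.2.1)) :=
    (natLeUn.comp (hw.pair hQ) :)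
  have hcnt : CodeFP rkInE natE (fun a => qCount a.2.2.1 a.1 a.2.1) := (qCountFP.comp (hn.pair (hQ.pair hΔ)) :)
  have hlog : CodeFP rkInE natE (fun a => Nat.log 2 (qCount a.2.2.1 a.1 a.2.1)) := (kappaFP.comp (hn.pair (hQ.pair hΔ)) :)
  have hbud : CodeFP rkInE unE (fun a => (natE (qCount a.2.2.1 a.1 a.2.1)).length) := (strLength.comp (strOfNat.comp hcnt) :)
  have hlogu : CodeFP rkInE unE (fun a => min (Nat.log 2 (qCount a.2.2.1 a.1 a.2.1)) (natE (qCount a.2.2.1 a.1 a.2.1)).length) :=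
    (unOfNatMin.comp (hbud.pair hlog) :)
  have hpow : CodeFP rkInE natE (fun a => 2 ^ min (Nat.log 2 (qCount a.2.2.1 a.1 a.2.1)) (natE (qCount a.2.2.1 a.1 a.2.1)).length) :=
    (natPow.comp ((const _ 2).pair hlogu) :)
  have h2 : CodeFP rkInE bitE (fun a => decide (rank a.2.2.1 a.1 a.2.1 (fun j => a.2.2.2.getD j 0) <
      2 ^ min (Nat.log 2 (qCount a.2.2.1 a.1 a.2.1)) (natE (qCount a.2.2.1 a.1 a.2.1)).length)) :=
    (natLt.comp (rankFP.pair hpow) :)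
  refine ((h1.and h2).congr fun a => ?_)
  rw [length_natE, min_eq_left (log_two_le_size _), ← sum_qWeight_getD, Bool.decide_and]

/-- **What the test decides** (`Δ ≥ 1`): for a list `x` of coordinates, the vector `j ↦ x[j]` (`j < n`)
lies in `pointSet n Q Δ` iff the test accepts. [folklore] -/
theorem decide_memPointSet_iff {Δ : ℕ} (hΔ : 0 < Δ) (n Q : ℕ) (xs : List ℤ) :
    ((∑ j : Fin n, qWeight Δ (xs.getD j 0)) ≤ Q ∧ rank Δ n Q (fun j => xs.getD j 0) < 2 ^ Nat.log 2 (qCount Δ n Q)) ↔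
      (fun j : Fin n => xs.getD j 0) ∈ pointSet n Q Δ hΔ := by
  rw [mem_pointSet_iff_rank, mem_qBall_iff hΔ, kappa_eq_log_qCount hΔ]

/-! ### Unpacked forms (`∃ f ∈ FP, …`) -/

/-- **Unranking, unpacked**: an `FP` string function mapping `⟨1ⁿ, ⟨1^Q, ⟨bin Δ, bin i⟩⟩⟩` to the raw list
code of the coordinates of `unrank Δ n Q i`. [cite: Regev2004, Lemma 3.11 (exact variant)] -/
theorem exists_fp_unrank : ∃ f ∈ FP, ∀ n Q Δ i : ℕ,
    f (boolPair (unE n) (boolPair (unE Q) (boolPair (natE Δ) (natE i)))) = rawE intE (List.ofFn (unrank Δ n Q i)) := by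
  obtain ⟨f, hf, h⟩ := unrankFP
  exact ⟨f, hf, fun n Q Δ i => h (n, (Q, (Δ, i)))⟩

/-- **Ranking, unpacked**: an `FP` string function mapping `⟨1ⁿ, ⟨1^Q, ⟨bin Δ, rawE intE x⟩⟩⟩` to
`bin (rank Δ n Q (j ↦ x[j]))`. [cite: Regev2004, Lemma 3.12 (proof; exact variant)] -/
theorem exists_fp_rank : ∃ f ∈ FP, ∀ (n Q Δ : ℕ) (x : List ℤ),
    f (boolPair (unE n) (boolPair (unE Q) (boolPair (natE Δ) (rawE intE x)))) = natE (rank Δ n Q fun j => x.getD j 0) := by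
  obtain ⟨f, hf, h⟩ := rankFP
  exact ⟨f, hf, fun n Q Δ x => h (n, (Q, (Δ, x)))⟩

/-- **The count and the number of coins, unpacked**: `FP` string functions mapping `⟨1ⁿ, ⟨1^Q, bin Δ⟩⟩` to
`bin |qBall n Q Δ|` and to `bin κ`, `κ = ⌊log₂ |qBall n Q Δ|⌋` (`Δ ≥ 1`). [cite: Regev2004, Lemma 3.11 (exact variant)] -/
theorem exists_fp_card_qBall : (∃ f ∈ FP, ∀ n Q Δ : ℕ, 0 < Δ →
    f (boolPair (unE n) (boolPair (unE Q) (natE Δ))) = natE (qBall n Q Δ).card) ∧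
    (∃ f ∈ FP, ∀ n Q Δ : ℕ, 0 < Δ → f (boolPair (unE n) (boolPair (unE Q) (natE Δ))) = natE (kappa n Q Δ)) := by
  obtain ⟨f, hf, h⟩ := qCountFP
  obtain ⟨g, hg, h'⟩ := kappaFP
  exact ⟨⟨f, hf, fun n Q Δ hΔ => by rw [← qCount_eq_card hΔ]; exact h (n, (Q, Δ))⟩,
    ⟨g, hg, fun n Q Δ hΔ => by rw [kappa_eq_log_qCount hΔ]; exact h' (n, (Q, Δ))⟩⟩

/-- **The membership test, unpacked**: an `FP` string function mapping `⟨1ⁿ, ⟨1^Q, ⟨bin Δ, rawE intE x⟩⟩⟩` to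
the bit `[(j ↦ x[j]) ∈ pointSet n Q Δ]` (`Δ ≥ 1`). [cite: Regev2004, Lemma 3.12 (proof; exact variant)] -/
theorem exists_fp_mem_pointSet : ∃ f ∈ FP, ∀ (n Q Δ : ℕ) (hΔ : 0 < Δ) (x : List ℤ),
    f (boolPair (unE n) (boolPair (unE Q) (boolPair (natE Δ) (rawE intE x)))) =
      [decide ((fun j : Fin n => x.getD j 0) ∈ pointSet n Q Δ hΔ)] := by
  obtain ⟨f, hf, h⟩ := memPointSetFP
  refine ⟨f, hf, fun n Q Δ hΔ x => ?_⟩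
  have e := h (n, (Q, (Δ, x)))
  simp only [rkInE, pairE_apply, bitE] at e
  rw [e]
  simp only [decide_memPointSet_iff hΔ n Q x]

end Regev2004

end Literature.Algebra.EuclideanLattices
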